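/-
Copyright: lit-balaban Phase-2 proof seat p34 (gen 17).  Statement-level skeleton of a published paper; no proof claims beyond what the
kernel checks below.
-/
import Literature.MathematicalPhysics.QuantumFieldTheory.BalabanImbrieJaffe1984to88.BIJ85ScalarPropagatorSupDecayDeriv
import Literature.MathematicalPhysics.QuantumFieldTheory.BalabanImbrieJaffe1984to88.BIJ88NeumannPropagatorSmallFieldSupDecay

/-!
# [Balaban1983RegularityDecay] (1.10) p. 573 / [BalabanImbrieJaffe1988] p. 263 / [BalabanImbrieJaffe1985] §7.3 p. 326 — **THE
# COVARIANT-DERIVATIVE MEMBER OF THE SUP-NORM DECAY FOR THE CUBE NEUMANN PROPAGATORS `G_k(□,u)` AT SMALL NON-FLAT FIELDS, `k`-UNIFORM,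
# IN OPERATOR (`‖f‖_∞`) FORM, AT THE BONDS OF DEPTH `≥ L^k` IN THE CUBE:  `|(D_uG_k(□,u)f)(b)| ≤ c₁(L^kε)e^{−t₀ dist(b, supp f)/L^k}‖f‖_∞`**;
# v1.1 (§6): the members in the (H1.10″)-type INPUT shape of the hypothesis-form chain, and at every gauge copy `u^h`
# v1.2 (§7): the members under (7.3.1) with a threshold depending on `(d, L^k)` ONLY (blockwise centred gauge; no ball radius)

T. Bałaban, *Regularity and decay of lattice Green's functions*, Commun. Math. Phys. **89** (1983) 571–597 [Balaban1983RegularityDecay],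
Theorem p. 573, (1.10); T. Bałaban, J. Imbrie, A. Jaffe, *Effective action and cluster properties of the abelian Higgs model*, Commun.
Math. Phys. **114** (1988) 257–315 [BalabanImbrieJaffe1988], Sect. 2 p. 263 [PDF 7], the sentence after (2.33); T. Bałaban, J. Imbrie,
A. Jaffe, *Renormalization of the Higgs model: minimizers, propagators and the stability of mean field theory*, Commun. Math. Phys. **97**
(1985) 299–329 [BalabanImbrieJaffe1985], §7.3 p. 326 [PDF 28] ([7] there = [6] of [BalabanImbrieJaffe1988] = [Balaban1983RegularityDecay]).

statement-level skeleton of published theorems with citation tags; proofs where landed; nothing here is a claim about the Yang–Mills mass gap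

PDF held: `paper:balaban1983-cmp89-regularity-decay` (journal page = PDF page + 570), p. 573 [PDF 3] re-read this session from the text layer
(`lit read … --pages 2-4`); `paper:balaban1988-cmp114-bij-abelian-higgs-effective-action` (journal page = PDF page + 256), p. 263 [PDF 7];
`paper:balaban1985-cmp97-bij-higgs-minimizers` (journal page = PDF page + 298), p. 326 [PDF 28] (both as quoted verbatim in this seat's gen-16
headers `BIJ88NeumannPropagatorSmallFieldRegion` / `BIJ88NeumannPropagatorSmallPlaquetteRegion`).

CITATION HEADER (lean-in-tree rule).  Part of the lit-balaban TYPED SKELETON (HOME `run/shared/lean/pub/lit-balaban/`), PHASE-2 proof seat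
p34 gen 17 (unit `lit-balaban-p34-g17`; TAKING line HOME/STATUS.md 2026-08-23T01:43:25Z; free-target protocol G.5-34(d) — SOURCE: the
successor item declared by p27 gen 34 in the HONEST SCOPE (i) of `BIJ88NeumannPropagatorSmallFieldSupDecay` (p347259): *"The VALUE member of
(1.10)/(2.30) only; the covariant-derivative member |(D_uG_k(□,u)f)(b)| in operator form … not treated here (p34's §7–§8 give the derivative
member in kernel form)"*, = the cube form of p30 gen 25's whole-torus member `BIJ85ScalarPropagatorSupDecayDeriv.decay110_smallField_deriv`
(p345594), = the operator-form input p29 gen 29's `BIJ88LocDeriv230SmallFieldTorus` HONEST SCOPE (i) waits for; no objection in the window: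
r15 g14 01:46:50Z (*"no objection from the owner"*), p27 g34 01:47:14Z, r18 g24 01:54:54Z).  WHAT IS REPRODUCED: located members of rows
**C2.Claim@263** (*"Bounds analogous to (2.30), (2.31) hold for covariant derivatives … of G_{k,loc}(u)"*, owner r18; head = p08's abstract
hence-step, unchanged — this file is its INPUT for the cubes `□_α` at non-flat `u`), **C2.Eq2.30** / **C2.Eq2.27** (`HOME/lit-balaban-r18/ROWS-C2.md`)
and **C1.Eq7.3.1-7.3.2** (`HOME/lit-balaban-r15/ROWS-C1.md`, owner r15: the p. 326 sentence *"The propagators arising from Δ_k(u_k), under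
the restriction (7.3.1) on the gauge field, also satisfy the regularity and decay estimates of [7]"*, here the DERIVATIVE half of [7] (1.10)
for the CUBE propagators).  No head changes.  Kind «model-level theorems only» (no new definition, no `Prop`-valued fact; p27's / p30's /
p31's / p33's / gen-15–16's declarations used BY NAME).

THE PRINTED TEXT (verbatim).  [Balaban1983RegularityDecay] p. 573 [PDF 3] (text layer re-read): *"Theorem (Proposition 2.1 of [1]). For
α < 1 there exist positive constants δ₀, c₀, R₀ independent of A, k, Ω and depending on d, M only, c₀ on α also, such that for e sufficiently
small and for an arbitrary function f : Ω → R^N, we have [(1.9)] for x, x′ ∈ Ω, and satisfying the condition dist({x, x′}, Ω^c) ≥ R₀.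
Similarly |(D^η_{A,μ}G_k(Ω,A)f)(x)|, |(G_k(Ω,A)f)(x)| ≤ c₀exp(−δ₀dist(x, supp f))‖f‖_∞ (1.10) for x ∈ Ω, dist(x,Ω^c) ≥ R₀. … For some simple
sets Ω, e.g. for rectangular parallelepipeds, the inequalities hold without any restrictions on the points x, x′"*.  [BalabanImbrieJaffe1988]
p. 263 [PDF 7]: *"a straightforward application of the random walk expansion of [6] shows that |(G_{k,loc}(u)f)(x)| ≦ ce^{−c dist(suppt f,x)}
‖f‖_∞, (2.30) … We assume that u is smooth in the □_α's entering the sum in (2.27) … Bounds analogous to (2.30), (2.31) hold for covariant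
derivatives and Hölder derivatives of G_{k,loc}(u) of order less than two."*  [BalabanImbrieJaffe1985] p. 326 [PDF 28]: *"The propagators
arising from Δ_k(u_k), under the restriction (7.3.1) on the gauge field, also satisfy the regularity and decay estimates of [7]. In order to
remain within the framework of this reference, we remark that by change of gauge u_k can be transformed in a local region Λ into a
configuration of the form exp[ie_kηA], where A is smooth and small."*

THE OBJECTS (all with bodies, none defined here).  The cube `□ = cubeT hPd (L^k) c (L^k·M) = c·L^k + Π_i[0, L^kM_i)` of the fine torus
`T^{(0)}` (p31 `BIJ88NeumannPropagatorFlatDecayCube`; a union of `k`-blocks, shorter than the torus in every direction); its Neumann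
propagator `G_k(□,u) = gBox (α_kL^{kd}) ε⁻¹ u k □` (p31 `BIJ88NeumannPropagator227Torus`: the inverse on `ℓ²(□)` of `N_□(u) = (χ_□D_u)ᴴ(χ_□D_u)
+ α_kL^{kd}(Q_k(u)|_□)ᴴ(Q_k(u)|_□)`, extended by `0`); the covariant derivative `(D_uφ)(⟨x, x+e_μ⟩) = ε⁻¹(u_{x,μ}φ(x+e_μ) − φ(x))` (`covD ε⁻¹
(cfg u)`); the depth of a site `x ∈ □` = `dist_∞(x, T∖□)` in fine-lattice steps (`supDist`).  THE SMALLNESS OF THE FIELD: §4 takes BOTH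
p27's bondwise hypotheses on `□` (`|u_b − 1| ≤ T` on the intra-block bonds of `□*`, `|u(Γ^{(k)}_{x_k,x}) − 1| ≤ δ` on `□`, `2(L^k−1)L^k·d·T²
+ 2δ² ≤ 1/2` — they feed the VALUE member) AND the plaquette smallness of p30's member (`|u(∂p) − 1| ≤ θ` for every plaquette of the torus,
`2d³(L^{2k}θ)² ≤ 1` — it feeds the local axial gauges); §5 removes the bondwise hypotheses for cubes in a non-wrapping ball by print's own
change of gauge (p. 326), leaving (7.3.1)-type plaquette smallness ONLY.

THE MECHANISM (ours — DIVERGENCE OF METHOD from the printed route, disclosed as in p27's/p30's files: the print defers to an extension of [7]'s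
random-walk expansion; here p30's perturbative INTERIOR GRADIENT ESTIMATE, transplanted from the torus to the cube).  Fix `φ = G_k(□,u)f`.
(§1) THE CUBE EQUATION READ BY THE TORUS OPERATOR: at a site `z ∈ □` all of whose `2d` bonds lie in `□`, `(N_T(u)ψ)(z) = (N_□(u)ψ)(z)` for
every `ψ` (the Neumann cut removes only bonds leaving `□`; the restricted average keeps the whole `k`-block of `z`, `□` being a block union) —
so on a ball `B_{2r+1}(y₀) ⊆ □` the torus source `f′ := N_T(u′)ψ` of the gauge copy `ψ = hφ` IS `hf` (§2: `G_k(□,u^h)(hf) = hG_k(□,u)f`,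
`N_□(u^h)(hφ) = hf` on `□`), and p30's `local_gradient_bound` (stated for the torus operator with an arbitrary source `f′`, used only on the
`2r`-ball) applies VERBATIM at every bond `⟨y₀, y₀+e_{μ₀}⟩` of depth `> 2r + 1`: in the centre-rooted axial gauge `h` of
`BIJ85CentredAxialGauge` (`|u′ − 1| ≤ (d−1)|z − y₀|_∞θ` on the `2r`-ball, p. 326), with the flat torus kernel envelopes of
`BIJ85FlatPropagatorKernelDiffs`, the local sup `S` of `ψ` from p27's cube VALUE member `decay110_smallField_cube` (no depth needed), the local
sup `M_loc` of covariant differences and the local sup `F_loc` of `f`:  `|ψ(y₀+e_{μ₀}) − ψ(y₀)| ≤ C(F_loc ε²r + γr²M_loc + γrS + S/r +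
α_kε²(r + L^k)S)`.  (§4) THE DEPTH-WEIGHTED MAXIMUM PRINCIPLE: with the admissible half-radius `ρ(z) = (depth(z) − 2)/2`, the radius of
record `r_* = ⌊c·L^k⌋` (`c = c(d,L,a)` a small fraction) and the weight `W(z) = min(r_*, max(0, ρ(z)))/r_* ∈ [0,1]`, take the maximal bond
`b₀ = ⟨y₀, y₀+e_{μ₀}⟩` of `W(b₋)e^{t dist(b₋, supp f)/L^k}|u_bφ(b₊) − φ(b₋)|` over ALL bonds of the torus.  If `ρ(y₀) < 8` the weight is
`< 8/r_* ≤ 16/(cL^k)` and two VALUES of `φ` bound the maximum by `O(L^kε²)‖f‖_∞`.  If `ρ(y₀) ≥ 8`, run the interior estimate on the ball of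
radius `r = min(r_*, ⌊ρ(y₀)/2⌋) ≥ 4` (half the admissible one): the `(2r+1)`-ball lies in `□`, every bond of the `2r`-ball has weight
`≥ W(y₀)/2` (its depth is at least `depth(y₀) − 2r`), so `M_loc ≤ 2·M·e^{−tD₀/L^k}e/W(y₀)`; the contraction factor `2C·e·γr² ≤ 2C·e·c²
≤ 1/2` (`γ = (d−1)θ`, `(d−1)θL^{2k} ≤ 1`) absorbs the covariant-difference term, and the weight converts `S/r` into `S/r_* = O(L^kε²)‖f‖_∞`
(`W(y₀)/r ≤ 4/r_*`).  At a bond of depth `≥ L^k ≥ 2r_* + 2` the weight is `1`, whence the member with ONE power of `L^kε` where the value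
member has two; bonds with `cL^k < 4` by two values directly.  (§5) THE CHANGE OF GAUGE OF p. 326 for a fitting cube inside the
non-wrapping ball of sup-radius `R ≥ L^kM_i` around its corner: in p30's centred axial gauge of that ball `u^h` is bondwise `(d−1)Rθ`-small on
`□*` and its block holonomies on `□` are within `d(L^k−1)T` of `1` (p33's `norm_holCK_sub_one_le` for the field cut to the ball, gen 16's
locality `holCK_congr`); plaquettes and `|(D_uG_k(□,u)f)(b)|` are gauge invariant (`G_k(□,u^h)(hf) = hG_k(□,u)f`), so §4 at `u^h` gives the
member for `u` under (7.3.1)-type plaquette smallness alone.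

WHAT IS PROVED (theorems only; 0 `sorry`; standard axioms; no new definition, no `Prop`-valued fact).
* §0 (private) one-step sup-distance bookkeeping (as in p30's file, re-proved privately).
* §1 **`nOp_univ_mulVec_apply_eq_of_interior`** — `(N_T(u)ψ)(z) = (N_Ω(u)ψ)(z)` for a block union `Ω`, `z ∈ Ω` with `z ± e_ν ∈ Ω` for all
  `ν`, every `ψ`, every `a, c, u`.
* §2 **`gBox_gaugeAct_mulVec`** (`G_k(Ω,u^h)(hf) = h·G_k(Ω,u)f`), **`nOp_gaugeAct_mulVec_apply`** (`(N_Ω(u^h)(h·G_k(Ω,u)f))(z) = h(z)f(z)` on `Ω`).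
* §3 (private) `min_div_two_le`, `min_div_four_le`, `weight_mem`, `absorb_step`, `budget_step`, `shallow_step` — the real arithmetic of §4.
* §4 **`decay110_smallField_cube_deriv`** — for `1 ≤ d`, `d + 1 ≤ 3`, `L` odd `> 1`, `a > 0` THERE EXIST `t₀, c₁ > 0` (from `(d, L, a)`
  only) such that for every `P` with `P.d = d + 1`, `P.L = L`, every `1 ≤ k ≤ K`, every cube `□ = cubeT hPd (L^k) c (L^k·M)` (`M_i ≥ 1`,
  `c_iL^k + L^kM_i ≤ |T|`, `L^kM_i < |T|`), every `U(1)` field `u` and `θ, T, δ` with `0 ≤ θ`, `‖u(∂p) − 1‖ ≤ θ` for all plaquettes,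
  `2(d+1)³(L^{2k}θ)² ≤ 1`, p27's bondwise `(T, δ)` hypotheses on `□`, every bond `⟨x, x+e_μ⟩` with `L^k ≤ |x − w|_∞` for all `w ∉ □`, every `f`
  with `‖f‖ ≤ F` and `f(z) ≠ 0 → D ≤ |x − z|_∞`:  `‖(D_uG_k(□,u)f)(⟨x, x+e_μ⟩)‖ ≤ c₁(L^kε)e^{−t₀D/L^k}F`.
* §5 `norm_toC_plaqHol_gaugeAct_sub_one` (plaquette variables are gauge invariant), **`smallField_gaugeAct_cubeT`** (p27's `(T, δ)`
  hypotheses for `u^h` on a fitting cube in the centred gauge of the ball around its corner, from the plaquette smallness),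
  **`norm_covD_gBox_gaugeAct_mulVec`** (`|(D_{u^h}G_k(Ω,u^h)(hf))(b)| = |(D_uG_k(Ω,u)f)(b)|`), **`decay110_smallPlaquette_cube_deriv`** (§4 under
  the plaquette smallness ONLY: cube inside the ball of sup-radius `R ≥ L^kM_i` around its corner, `2R + 4 < |T|`, `T ≥ dRθ` — `d = P.d − 1`
  — with `2(L^k−1)L^k·(d+1)·T² + 2((d+1)(L^k−1)T)² ≤ 1/2`; NO gauge condition), **`decay110_smallPlaquette_cube_deriv_T`** (the same in
  p31's (1.10) shape: distance `B5Ineq137Torus.T`, rate `e^{−δ₀εD}`).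
* §6 (v1.1, append-only) **`decay110_smallField_cube_deriv_input`** / **`decay110_smallPlaquette_cube_deriv_input`** (§4 / §5 in r01's
  (H1.10″)-deriv binder shape of `BIJ85NeumannPropagatorRegularDeriv.input110_deriv_regular_deep`: distance `B5Ineq137Torus.T`, bound
  `P.spacing k * (c₁ * exp(−t₀((L^k)⁻¹D)) * F)`, deep rows as the ball condition `T x y < L^k → y ∈ □`), **`decay110_smallField_cube_deriv_gaugeAct`**
  (§4 for `G_k(□,u^h)`, `D_{u^h}`, every gauge transformation `h`, the twin of p27's `decay110_smallField_cube_gaugeAct`).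
* §7 (v1.2, append-only) **`decay110_smallPlaquette_cube_deriv_uniform`** (§4 for `u^h` in the BLOCKWISE centred gauge of gen 16's
  `BIJ88NeumannPropagatorSmallPlaquetteRegion.smallField_blockGauge` (v1.2; p27 gen 34's device): p27's bondwise `(T, δ)` hypotheses from the
  plaquette smallness alone for `2(L^k − 1) + 4 < |T|`, no enclosing ball — i.e. §5's member with the ball
  radius `R` REMOVED: `T ≥ d(L^k − 1)θ`, threshold depending on `(d, L^k)` only — uniform in the cube, the volume and the field; the derivative
  twin of p27's `decay110_smallPlaquette_cube_uniform`), **`decay110_smallPlaquette_cube_deriv_uniform_input`** (the same in §6's binder shape).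

HONEST SCOPE.  (i) DEEP BONDS ONLY: `dist_∞(x, T∖□) ≥ L^k` — one unit of the `L^{−k}`-lattice, i.e. [6]'s general restriction
*"dist(x, Ω^c) ≥ R₀"* with `R₀ = 1`; [6]'s REMARK that for rectangular parallelepipeds no restriction is needed is NOT reproduced (the
Neumann boundary layer would need the reflection (2.42) of [6] for the flat kernel envelopes; not done).  The proof gives, more generally, the
degraded bound `× r_*/max(1, min(r_*, ρ(depth)))` at every bond of `□`; only the deep-bond statement is exported.  (ii) CUBES ONLY (chart
images of [6]'s boxes, `L^kM_i < |T|`, `M_i ≥ 1`), as p27's value member; a general block union `Ω` is not treated (p27's tilted-row input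
is for boxes).  (iii) `P.d = d + 1 ∈ {2, 3}` (p27's tilted row needs `≤ 3`, p30's flat kernel envelopes need `≥ 2`), `L` odd `> 1` (p30's
envelopes / centred gauge), `1 ≤ k ≤ K` (the flat tower).  (iv) The hypotheses of §4 are the UNION of p27's (bondwise, feeding the local sup)
and p30's (plaquettes, feeding the local gauges); §5 derives the former from the latter for cubes in a non-wrapping ball, at the price of the
displayed threshold `θ ≲ (d^{3/2}L^kR)^{−1}` (gen 16's HONEST SCOPE (ii) of `BIJ88NeumannPropagatorSmallPlaquetteRegion` applies verbatim);
§7 (v1.2) replaces the ball radius `R` by the block radius `L^k − 1` (blockwise gauge): threshold `θ ≲ (d^{3/2}L^{2k})^{−1}`, uniform in the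
cube and the volume;
that the ACTUAL backgrounds of the induction meet (7.3.1)-type plaquette smallness at small `e_k` is p33's lane (`BIJ85Claim73PropagatorDecay`),
not restated.  (v) Constants `t₀ = min(t_v, 1)`, `c₁ = 2C_LK₁ + 32e·c_v/c + 1` explicit in the proof from p27's `(t_v, c_v)`, p30's `C_L`,
`C_K`; depending on `(d, L, a)` only — uniform in `k`, the cube, the volume and the field.  (vi) No Hölder member (1.9) (p30 g26's lane on
the torus), no closeness member (1.11)–(1.12), no `(2.31)`-analogue; the VALUE member under (7.3.1) alone is p27's v1.1
`decay110_smallPlaquette_cube` (p348389), not restated here.  (vii) `set_option maxHeartbeats 800000` on §4 (long bookkeeping; `linarith only`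
throughout).  DIVERGENCE OF METHOD as stated.  Nothing here is summit progress, continuum or Clay.  Unit `lit-balaban-p34`
(literature-prover-lit-balaban-p34-g17-0), HOME `run/shared/lean/pub/lit-balaban/`, 2026-08-23; v1.1 (§6 appended, §0–§5 byte-identical)
2026-08-23; v1.2 (§7 appended, §0–§6 byte-identical) 2026-08-23.
-/

open scoped BigOperators ComplexConjugate
open Finset Matrix

namespace Literature.MathematicalPhysics.QuantumFieldTheory.BalabanImbrieJaffe1984to88.BIJ88NeumannPropagatorSmallFieldCubeDeriv

open Literature.MathematicalPhysics.QuantumFieldTheory.Balaban1983to89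
open LatticeFieldCalculus (supDist)
open B3TorusRadialSums (cdist cdist_le_supDist supDist_comm supDist_eq_sup_cdist supDist_eq_zero_iff cdist_neg cdist_le_val)
open BIJ85Ineq722Torus (supDist_triangle)
open BIJ88Sect3Statements (U1 toC cfg covD starB mem_starB norm_toC toC_one)
open BIJ85BlockAveragesTorus BIJ85BlockAveragesTorusK
open BIJ88NeumannNoZeroModesTorus (IsBlockUnion)
open BIJ88NeumannPropagator227Torus (nOp gBox dN qMatK proj nOp_eq qMatK_apply qMatK_mulVec proj_mulVec)
open BIJ88NeumannPropagatorFlatDecayCube (cubeT isBlockUnion_cubeT)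
open BIJ88NeumannPropagatorSmallFieldRegion (nOp_mulVec_gBox_mulVec gBox_mulVec_eq_zero_of_not_mem)
open BIJ88DeltaLoc234Torus (mulOp gBox_gaugeAct conjTranspose_mul_mulOp)
open BIJ85CovariantHiggsDictionary (gram_dN_mulVec_apply_region)
open BIJ85ScalarPropagatorSupDecayDeriv (local_gradient_bound cfg_gaugeAct_apply norm_covDiff_gaugeAct dist1_plaqHol_le_of_plaqC
  two_mul_pow_le_sitesPerDir gamma_nsq_le_one)
open BIJ88NeumannPropagatorSmallFieldSupDecay (decay110_smallField_cube)

noncomputable section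

variable {P : Params}

/-! ## §0 Torus bookkeeping (one lattice step in the sup-distance) -/

/-- kernel: the `μ`-coordinate of `z + e_μ` is `z_μ + 1`. [folklore] -/
private theorem shift_apply_self' (z : Balaban1983to89.Site P 0) (μ : Fin P.d) : z.shift μ μ = z μ + 1 := by
  simp [Balaban1983to89.Site.shift]

/-- kernel: the other coordinates of `z + e_μ` are those of `z`. [folklore] -/
private theorem shift_apply_ne' (z : Balaban1983to89.Site P 0) {μ ν : Fin P.d} (h : ν ≠ μ) : z.shift μ ν = z ν := by
  simp [Balaban1983to89.Site.shift, Function.update_of_ne h]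

/-- kernel: one lattice step moves the sup distance by at most one. [folklore] -/
private theorem supDist_shift_le_one' (x : Balaban1983to89.Site P 0) (μ : Fin P.d) : supDist x (x.shift μ) ≤ 1 := by
  rw [supDist_eq_sup_cdist]
  refine Finset.sup_le fun ν _ => ?_
  by_cases hν : ν = μ
  · subst hν
    have h : x ν - x.shift ν ν = -1 := by rw [shift_apply_self']; ring
    rw [h, cdist_neg]
    exact (cdist_le_val _).trans (by rw [ZMod.val_one_eq_one_mod]; exact Nat.mod_le 1 _)
  · rw [shift_apply_ne' x hν, sub_self]
    exact (cdist_le_val _).trans (by simp)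

/-- kernel: `|y₀ − (z+e_μ)|_∞ ≤ |y₀ − z|_∞ + 1`. [folklore] -/
private theorem supDist_shift_le_succ (y₀ z : Balaban1983to89.Site P 0) (μ : Fin P.d) : supDist y₀ (z.shift μ) ≤ supDist y₀ z + 1 :=
  (supDist_triangle y₀ z (z.shift μ)).trans (Nat.add_le_add_left (supDist_shift_le_one' z μ) _)

/-- kernel: `(z − e_μ) + e_μ = z`. [folklore] -/
private theorem unshift_shift' (z : Balaban1983to89.Site P 0) (μ : Fin P.d) : (z.unshift μ).shift μ = z :=
  (LatticeFieldCalculus.shiftEquiv μ).right_inv z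

/-- kernel: `|y₀ − (z−e_μ)|_∞ ≤ |y₀ − z|_∞ + 1`. [folklore] -/
private theorem supDist_unshift_le_succ (y₀ z : Balaban1983to89.Site P 0) (μ : Fin P.d) :
    supDist y₀ (z.unshift μ) ≤ supDist y₀ z + 1 := by
  have h := supDist_triangle y₀ z (z.unshift μ)
  have h1 : supDist z (z.unshift μ) ≤ 1 := by
    have h2 := supDist_shift_le_one' (z.unshift μ) μ
    rwa [unshift_shift', supDist_comm] at h2
  exact h.trans (Nat.add_le_add_left h1 _)

/-! ## §1 The torus operator and the Neumann operator of a block union agree on interior rows -/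

/-- kernel: **`(N_T(u)ψ)(z) = (N_Ω(u)ψ)(z)` at every site `z ∈ Ω` all of whose `2d` bonds lie in `Ω`**, for a union `Ω` of `k`-blocks (the
Neumann cut `χ_Ω` only removes bonds leaving `Ω`, and the restricted average `Q_k(u)|_Ω` keeps the whole block of `z`); no support
condition on `ψ`. [cite: BalabanImbrieJaffe1988, (2.27) p.263] -/
theorem nOp_univ_mulVec_apply_eq_of_interior {k : ℕ} (a c : ℝ) (U : GaugeField P 0 U1) {Ω : Finset (Balaban1983to89.Site P 0)}
    (hΩ : IsBlockUnion k Ω) (ψ : Balaban1983to89.Site P 0 → ℂ) {z : Balaban1983to89.Site P 0} (hz : z ∈ Ω)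
    (hs : ∀ ν, z.shift ν ∈ Ω) (hu : ∀ ν, z.unshift ν ∈ Ω) :
    (nOp a c U k univ *ᵥ ψ) z = (nOp a c U k Ω *ᵥ ψ) z := by
  classical
  -- the covariant Laplacian part: every bond at `z` is a bond of `Ω`
  have hD : (((dN c U univ)ᴴ * dN c U univ) *ᵥ ψ) z = (((dN c U Ω)ᴴ * dN c U Ω) *ᵥ ψ) z := by
    rw [gram_dN_mulVec_apply_region c U univ ψ z, gram_dN_mulVec_apply_region c U Ω ψ z]
    refine congrArg (fun s => (c : ℂ) ^ 2 * s) (Finset.sum_congr rfl fun ν _ => ?_)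
    have h1 : (⟨z, ν⟩ : PBond P 0) ∈ starB (univ : Finset (Balaban1983to89.Site P 0)) := (mem_starB _ _).2 ⟨mem_univ _, mem_univ _⟩
    have h2 : (⟨z.unshift ν, ν⟩ : PBond P 0) ∈ starB (univ : Finset (Balaban1983to89.Site P 0)) :=
      (mem_starB _ _).2 ⟨mem_univ _, mem_univ _⟩
    have h3 : (⟨z, ν⟩ : PBond P 0) ∈ starB Ω := (mem_starB _ _).2 ⟨hz, hs ν⟩
    have h4 : (⟨z.unshift ν, ν⟩ : PBond P 0) ∈ starB Ω := (mem_starB _ _).2 ⟨hu ν, by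
      show (z.unshift ν).shift ν ∈ Ω
      rw [unshift_shift']; exact hz⟩
    rw [if_pos h1, if_pos h2, if_pos h3, if_pos h4]
  -- the block-average part: the block of `z` lies in `Ω`
  have hQ : (((qMatK U k univ)ᴴ * qMatK U k univ) *ᵥ ψ) z = (((qMatK U k Ω)ᴴ * qMatK U k Ω) *ᵥ ψ) z := by
    rw [← mulVec_mulVec, ← mulVec_mulVec]
    simp only [mulVec, dotProduct, conjTranspose_apply]
    refine Finset.sum_congr rfl fun y _ => ?_
    by_cases hzy : z ∈ blockK k y
    · have hy : blkIter k z = y := mem_blockK.1 hzy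
      have hsub : blockK k y ⊆ Ω := by rw [← hy]; exact hΩ z hz
      have e1 : qMatK U k univ y z = qMatK U k Ω y z := by
        rw [qMatK_apply, qMatK_apply, if_pos ⟨subset_univ _, hzy⟩, if_pos ⟨hsub, hzy⟩]
      have e2 : ∀ x, qMatK U k univ y x * ψ x = qMatK U k Ω y x * ψ x := by
        intro x
        rw [qMatK_apply, qMatK_apply]
        by_cases hx : x ∈ blockK k y
        · rw [if_pos ⟨subset_univ _, hx⟩, if_pos ⟨hsub, hx⟩]
        · rw [if_neg (fun h => hx h.2), if_neg (fun h => hx h.2)]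
      rw [e1, Finset.sum_congr rfl fun x _ => e2 x]
    · have e1 : qMatK U k univ y z = 0 := by rw [qMatK_apply, if_neg (fun h => hzy h.2)]
      have e2 : qMatK U k Ω y z = 0 := by rw [qMatK_apply, if_neg (fun h => hzy h.2)]
      rw [e1, e2, star_zero, zero_mul, zero_mul]
  rw [nOp_eq, nOp_eq, add_mulVec, add_mulVec, Pi.add_apply, Pi.add_apply, smul_mulVec, smul_mulVec, Pi.smul_apply,
    Pi.smul_apply, hD, hQ]

/-! ## §2 The gauge copy of the cube problem -/

/-- kernel: **`G_k(Ω,u^h)(hf) = h·G_k(Ω,u)f`** on a block union ((2.7): `G_k(Ω,u^h) = M_hG_k(Ω,u)M_hᴴ`, p31's `gBox_gaugeAct`).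
[cite: BalabanImbrieJaffe1985, (2.7) p.303] -/
theorem gBox_gaugeAct_mulVec {k : ℕ} (hk : 0 + k ≤ P.m + P.K) {a c : ℝ} (hc : c ≠ 0) (ha : 0 < a) (h : GaugeTransf P 0 U1)
    (U : GaugeField P 0 U1) {Ω : Finset (Balaban1983to89.Site P 0)} (hΩ : IsBlockUnion k Ω) (f : Balaban1983to89.Site P 0 → ℂ) :
    gBox a c (GaugeField.gaugeAct h U) k Ω *ᵥ (fun z => toC (h z) * f z) = fun z => toC (h z) * (gBox a c U k Ω *ᵥ f) z := by
  have e1 : (fun z => toC (h z) * f z) = mulOp h *ᵥ f := by funext z; rw [mulOp, mulVec_diagonal]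
  have e2 : (fun z => toC (h z) * (gBox a c U k Ω *ᵥ f) z) = mulOp h *ᵥ (gBox a c U k Ω *ᵥ f) := by
    funext z; rw [mulOp, mulVec_diagonal]
  rw [e1, e2, gBox_gaugeAct hk hc ha h U hΩ, ← mulVec_mulVec, ← mulVec_mulVec, mulVec_mulVec f, conjTranspose_mul_mulOp, one_mulVec]

/-- kernel: **the gauge copy solves the cube problem with source `hf`**: `(N_Ω(u^h)(h·G_k(Ω,u)f))(z) = h(z)f(z)` for `z ∈ Ω`.
[cite: BalabanImbrieJaffe1985, (2.7) p.303] -/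
theorem nOp_gaugeAct_mulVec_apply {k : ℕ} (hk : 0 + k ≤ P.m + P.K) {a c : ℝ} (hc : c ≠ 0) (ha : 0 < a) (h : GaugeTransf P 0 U1)
    (U : GaugeField P 0 U1) {Ω : Finset (Balaban1983to89.Site P 0)} (hΩ : IsBlockUnion k Ω) (f : Balaban1983to89.Site P 0 → ℂ)
    {z : Balaban1983to89.Site P 0} (hz : z ∈ Ω) :
    (nOp a c (GaugeField.gaugeAct h U) k Ω *ᵥ (fun w => toC (h w) * (gBox a c U k Ω *ᵥ f) w)) z = toC (h z) * f z := by
  rw [← gBox_gaugeAct_mulVec hk hc ha h U hΩ f, nOp_mulVec_gBox_mulVec hk hc ha _ hΩ, proj_mulVec, if_pos hz]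

/-! ## §3 Scalar bookkeeping (all real arithmetic of the absorption step, kept out of the long proof) -/

/-- kernel: `min(A, B)/2 ≤ min(A, B/2)` for `A ≥ 0`. [folklore] -/
private theorem min_div_two_le {A B : ℝ} (hA : 0 ≤ A) : min A B / 2 ≤ min A (B / 2) := by
  rcases le_total A B with h | h
  · rw [min_eq_left h]; exact le_min (by linarith) (by linarith)
  · rw [min_eq_right h]; exact le_min (by linarith) (by linarith)

/-- kernel: `min(A, B)/4 ≤ min(A, B/2 − 1)` for `A ≥ 0`, `B ≥ 4`. [folklore] -/
private theorem min_div_four_le {A B : ℝ} (hA : 0 ≤ A) (hB : 4 ≤ B) : min A B / 4 ≤ min A (B / 2 - 1) := by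
  rcases le_total A B with h | h
  · rw [min_eq_left h]; exact le_min (by linarith) (by linarith)
  · rw [min_eq_right h]; exact le_min (by linarith) (by linarith)

/-- kernel: the weight `min(R, max(0, ρ))/R` lies in `[0, 1]` (`R > 0`). [folklore] -/
private theorem weight_mem {R ρ : ℝ} (hR : 0 < R) : 0 ≤ min R (max 0 ρ) / R ∧ min R (max 0 ρ) / R ≤ 1 :=
  ⟨div_nonneg (le_min hR.le (le_max_left _ _)) hR.le, by rw [div_le_one hR]; exact min_le_left _ _⟩

/-- kernel: the ABSORPTION STEP — the local estimate `M·E/W ≤ C(F_loc ε²r + γr²·M_loc + (γr + 1/r + αε²(r+n))S)` with `F_loc = F·E·e`,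
`M_loc = 2M·E·e/W`, `S = S₀·E` and the contraction `2C·e·γr² ≤ 1/2` give `M ≤ 2·C·W·(F·e·ε²r + (γr + 1/r + αε²(r+n))S₀)`. [folklore] -/
private theorem absorb_step {M E W e C F ε r γ S₀ α n : ℝ} (hE : 0 < E) (hW : 0 < W) (hM : 0 ≤ M) (hr : 0 < r)
    (hκ : C * (γ * r ^ 2) * (2 * e) ≤ 1 / 2)
    (h : M * E / W ≤ C * ((F * E * e) * ε ^ 2 * r + γ * r ^ 2 * (2 * M * E * e / W) + γ * r * (S₀ * E) + (S₀ * E) / r +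
      α * ε ^ 2 * (r + n) * (S₀ * E))) :
    M ≤ 2 * (C * W * (F * e * ε ^ 2 * r + (γ * r + 1 / r + α * ε ^ 2 * (r + n)) * S₀)) := by
  set A : ℝ := C * W * (F * e * ε ^ 2 * r + (γ * r + 1 / r + α * ε ^ 2 * (r + n)) * S₀) with hA
  have h2 : M = (M * E / W) * (W / E) := by field_simp
  have h3 : C * ((F * E * e) * ε ^ 2 * r + γ * r ^ 2 * (2 * M * E * e / W) + γ * r * (S₀ * E) + (S₀ * E) / r +
      α * ε ^ 2 * (r + n) * (S₀ * E)) * (W / E) = A + (C * (γ * r ^ 2) * (2 * e)) * M := by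
    rw [hA]; field_simp; ring
  have h4 : M * E / W * (W / E) ≤ C * ((F * E * e) * ε ^ 2 * r + γ * r ^ 2 * (2 * M * E * e / W) + γ * r * (S₀ * E) + (S₀ * E) / r +
      α * ε ^ 2 * (r + n) * (S₀ * E)) * (W / E) := mul_le_mul_of_nonneg_right h (by positivity)
  rw [← h2, h3] at h4
  have h5 : (C * (γ * r ^ 2) * (2 * e)) * M ≤ (1 / 2) * M := mul_le_mul_of_nonneg_right hκ hM
  linarith

/-- kernel: the BUDGET of the absorbed terms — with `W ≤ 1`, `r ≤ cb·n ≤ n/8`, `γn² ≤ 1`, `W/r ≤ 8/(cb·n)`, `α·sp² ≤ a`, `sp = nε`: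
`W·(F·e·ε²r + (γr + 1/r + αε²(r+n))·c_v·sp²·F·e³) ≤ K₁·nε²F`, `K₁ = e·cb + c_v e³(cb + 8/cb + 2a)`. [folklore] -/
private theorem budget_step {W F e ε r γ cb n c_v sp α a : ℝ} (hW1 : W ≤ 1) (hF : 0 ≤ F) (he : 0 ≤ e)
    (hr : 0 < r) (hγ : 0 ≤ γ) (hcb : 0 < cb) (hn : 0 < n) (hcv : 0 ≤ c_v) (hα : 0 ≤ α) (ha : 0 ≤ a)
    (hrc : r ≤ cb * n) (hrn : r ≤ n / 8) (hγn : γ * n ^ 2 ≤ 1) (hWr : W / r ≤ 8 / (cb * n)) (hαa : α * sp ^ 2 ≤ a)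
    (hsp : sp = n * ε) :
    W * (F * e * ε ^ 2 * r + (γ * r + 1 / r + α * ε ^ 2 * (r + n)) * (c_v * sp ^ 2 * F * e ^ 3)) ≤
      (e * cb + c_v * e ^ 3 * (cb + 8 / cb + 2 * a)) * (n * ε ^ 2 * F) := by
  have hsp2 : sp ^ 2 = n ^ 2 * ε ^ 2 := by rw [hsp]; ring
  have q1 : W * (F * e * ε ^ 2 * r) ≤ (e * cb) * (n * ε ^ 2 * F) := by
    calc W * (F * e * ε ^ 2 * r) ≤ 1 * (F * e * ε ^ 2 * (cb * n)) := by gcongr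
      _ = (e * cb) * (n * ε ^ 2 * F) := by ring
  have q2 : W * (γ * r * (c_v * sp ^ 2 * F * e ^ 3)) ≤ (c_v * e ^ 3 * cb) * (n * ε ^ 2 * F) := by
    have h1 : γ * r * n ^ 2 ≤ cb * n := by
      calc γ * r * n ^ 2 ≤ γ * (cb * n) * n ^ 2 := by gcongr
        _ = cb * n * (γ * n ^ 2) := by ring
        _ ≤ cb * n * 1 := mul_le_mul_of_nonneg_left hγn (by positivity)
        _ = cb * n := mul_one _
    calc W * (γ * r * (c_v * sp ^ 2 * F * e ^ 3)) ≤ 1 * (γ * r * (c_v * sp ^ 2 * F * e ^ 3)) := by gcongr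
      _ = (γ * r * n ^ 2) * (c_v * ε ^ 2 * F * e ^ 3) := by rw [hsp2]; ring
      _ ≤ (cb * n) * (c_v * ε ^ 2 * F * e ^ 3) := mul_le_mul_of_nonneg_right h1 (by positivity)
      _ = (c_v * e ^ 3 * cb) * (n * ε ^ 2 * F) := by ring
  have q3 : W * (1 / r * (c_v * sp ^ 2 * F * e ^ 3)) ≤ (c_v * e ^ 3 * (8 / cb)) * (n * ε ^ 2 * F) := by
    have h3 : W / r * n ^ 2 ≤ (8 / cb) * n := by
      calc W / r * n ^ 2 ≤ (8 / (cb * n)) * n ^ 2 := mul_le_mul_of_nonneg_right hWr (by positivity)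
        _ = (8 / cb) * n := by field_simp
    calc W * (1 / r * (c_v * sp ^ 2 * F * e ^ 3)) = (W / r * n ^ 2) * (c_v * ε ^ 2 * F * e ^ 3) := by rw [hsp2]; ring
      _ ≤ ((8 / cb) * n) * (c_v * ε ^ 2 * F * e ^ 3) := mul_le_mul_of_nonneg_right h3 (by positivity)
      _ = (c_v * e ^ 3 * (8 / cb)) * (n * ε ^ 2 * F) := by ring
  have q4 : W * (α * ε ^ 2 * (r + n) * (c_v * sp ^ 2 * F * e ^ 3)) ≤ (c_v * e ^ 3 * (2 * a)) * (n * ε ^ 2 * F) := by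
    have h1 : r + n ≤ 2 * n := by linarith
    calc W * (α * ε ^ 2 * (r + n) * (c_v * sp ^ 2 * F * e ^ 3)) ≤ 1 * (α * ε ^ 2 * (r + n) * (c_v * sp ^ 2 * F * e ^ 3)) := by gcongr
      _ = (α * sp ^ 2) * (r + n) * (c_v * ε ^ 2 * F * e ^ 3) := by ring
      _ ≤ a * (2 * n) * (c_v * ε ^ 2 * F * e ^ 3) := by gcongr
      _ = (c_v * e ^ 3 * (2 * a)) * (n * ε ^ 2 * F) := by ring
  have hexp : W * (F * e * ε ^ 2 * r + (γ * r + 1 / r + α * ε ^ 2 * (r + n)) * (c_v * sp ^ 2 * F * e ^ 3))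
      = W * (F * e * ε ^ 2 * r) + W * (γ * r * (c_v * sp ^ 2 * F * e ^ 3)) + W * (1 / r * (c_v * sp ^ 2 * F * e ^ 3)) +
        W * (α * ε ^ 2 * (r + n) * (c_v * sp ^ 2 * F * e ^ 3)) := by ring
  have hK : (e * cb + c_v * e ^ 3 * (cb + 8 / cb + 2 * a)) * (n * ε ^ 2 * F) = (e * cb) * (n * ε ^ 2 * F) +
      (c_v * e ^ 3 * cb) * (n * ε ^ 2 * F) + (c_v * e ^ 3 * (8 / cb)) * (n * ε ^ 2 * F) + (c_v * e ^ 3 * (2 * a)) * (n * ε ^ 2 * F) := by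
    ring
  rw [hexp, hK]; linarith [q1, q2, q3, q4]

/-- kernel: the SHALLOW-BOND budget — `(8/rm)·(2e·c_v·sp²·F) ≤ (32e·c_v/cb)·nε²F` when `rm ≥ cb·n/2`, `sp = nε`. [folklore] -/
private theorem shallow_step {rm cb n e c_v sp ε F : ℝ} (hrm : 0 < rm) (hcb : 0 < cb) (hn : 0 < n) (he : 0 ≤ e) (hcv : 0 ≤ c_v)
    (hF : 0 ≤ F) (hrm2 : cb * n / 2 ≤ rm) (hsp : sp = n * ε) :
    (8 / rm) * (2 * e * c_v * sp ^ 2 * F) ≤ (32 * e * c_v / cb) * (n * ε ^ 2 * F) := by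
  have hsp2 : sp ^ 2 = n ^ 2 * ε ^ 2 := by rw [hsp]; ring
  have h4 : 8 / rm * n ≤ 16 / cb := by
    rw [div_mul_eq_mul_div, div_le_div_iff₀ hrm hcb]
    nlinarith [hrm2, hn.le, hcb.le]
  have h5 : 0 ≤ 2 * e * c_v * (n * ε ^ 2 * F) := by positivity
  calc 8 / rm * (2 * e * c_v * sp ^ 2 * F) = (8 / rm * n) * (2 * e * c_v * (n * ε ^ 2 * F)) := by rw [hsp2]; ring
    _ ≤ (16 / cb) * (2 * e * c_v * (n * ε ^ 2 * F)) := mul_le_mul_of_nonneg_right h4 h5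
    _ = (32 * e * c_v / cb) * (n * ε ^ 2 * F) := by ring

/-! ## §4 [6] (1.10), COVARIANT-DERIVATIVE member, for the CUBE propagators at small non-flat fields, `k`-uniform, deep bonds -/

section Main

set_option maxHeartbeats 800000 in
/-- **THE SUP-NORM DECAY OF THE COVARIANT DERIVATIVE OF THE CUBE NEUMANN PROPAGATOR `G_k(□,u)` AT SMALL NON-FLAT FIELDS, `k`-UNIFORM, AT
THE BONDS OF DEPTH `≥ L^k` IN THE CUBE** — the COVARIANT-DERIVATIVE member of [Balaban1983RegularityDecay] (1.10) *"|(D^η_{A,μ}G_k(Ω, A)f)(x)|,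
|(G_k(Ω, A)f)(x)| ≤ c₀exp(−δ₀ dist(x, supp f))‖f‖_∞ (1.10) for x ∈ Ω, dist(x,Ω^c) ≥ R₀"* (here `R₀ =` one unit of the `L^{−k}`-lattice
`= L^k` fine steps) for [BalabanImbrieJaffe1988] p. 263 *"Bounds analogous to (2.30), (2.31) hold for covariant derivatives … of
G_{k,loc}(u)"* / [BalabanImbrieJaffe1985] p. 326 *"The propagators arising from Δ_k(u_k), under the restriction (7.3.1) on the gauge
field, also satisfy the regularity and decay estimates of [7]"*, for p31's CUBE propagator of record `G_k(□,u) = gBox (α_kL^{kd}) ε⁻¹ u k □`,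
`□ = cubeT hPd (L^k) c (L^k·M)`, under the hypotheses of p27's VALUE member `decay110_smallField_cube` (bondwise `(T, δ)`-smallness on `□`)
and of p30's whole-torus derivative member (plaquettes within `θ` of `1` — print's (7.3.1) — with `2d³(L^{2k}θ)² ≤ 1`): for
`d + 1 ∈ {2, 3}`, `L` odd `> 1`, `a > 0`
there are `t₀, c₁ > 0` (depending on `d, L, a` only) such that for every volume, every `1 ≤ k ≤ K`, every fitting cube, every such field,
every bond `⟨x, x + e_μ⟩` with `dist_∞(x, T∖□) ≥ L^k` and every `f` with `|f| ≤ F` vanishing at sup-distance `< D` from `x`: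
`|(D_uG_k(□,u)f)(⟨x, x+e_μ⟩)| ≤ c₁(L^kε)e^{−t₀D/L^k}F`.  Method (ours; the print defers to an extension of [7]'s random-walk proofs): p30's
interior gradient estimate `local_gradient_bound` at a bond deep inside `□` in the centre-rooted axial gauge (the torus operator applied to
the gauge copy `hψ` reproduces the cube equation on the rows whose bonds lie in `□`, `nOp_univ_mulVec_apply_eq_of_interior`), p27's cube value
bound for the local sup, and a DEPTH-WEIGHTED maximum principle over the bonds of `□` (weight `min(r, ρ(depth))/r`, balls of half the
admissible radius) absorbing the covariant-difference term; bonds within `O(1)` of `∂□` carry weight `O(1/r)` and are covered by two values.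
[cite: BalabanImbrieJaffe1985, (7.3.1) p.326; Balaban1983RegularityDecay, (1.10) p.573] -/
theorem decay110_smallField_cube_deriv (d L : ℕ) (hd1 : 1 ≤ d) (hd3 : d + 1 ≤ 3) (hL : Odd L ∧ 1 < L) {a : ℝ} (ha : 0 < a) :
    ∃ t₀ c₁ : ℝ, 0 < t₀ ∧ 0 < c₁ ∧ ∀ (P : Params) (hPd : P.d = d + 1), P.L = L →
      ∀ k : ℕ, 1 ≤ k → k ≤ P.K → ∀ (c M : Fin (d + 1) → ℕ), (∀ i, 1 ≤ M i) →
        (∀ i, c i * P.L ^ k + P.L ^ k * M i ≤ P.sitesPerDir 0) → (∀ i, P.L ^ k * M i < P.sitesPerDir 0) →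
        ∀ (U : GaugeField P 0 U1) (θ T δ : ℝ), 0 ≤ θ →
          (∀ p : Balaban1983to89.Plaq P 0, ‖toC (GaugeField.plaqHol U p) - 1‖ ≤ θ) →
          2 * (P.d : ℝ) ^ 3 * (((P.L : ℝ) ^ k) ^ 2 * θ) ^ 2 ≤ 1 →
          (∀ b ∈ starB (cubeT hPd (P.L ^ k) c fun i => P.L ^ k * M i), blkIter k b.src = blkIter k b.tgt → ‖toC (U b) - 1‖ ≤ T) →
          (∀ y ∈ cubeT hPd (P.L ^ k) c (fun i => P.L ^ k * M i), ‖holCK U k y - 1‖ ≤ δ) →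
          2 * (((P.L : ℝ) ^ k - 1) * (P.L : ℝ) ^ k) * P.d * T ^ 2 + 2 * δ ^ 2 ≤ 1 / 2 →
          ∀ (x : Balaban1983to89.Site P 0) (μ : Fin P.d) (f : Balaban1983to89.Site P 0 → ℂ) (F D : ℝ),
            (∀ z, ‖f z‖ ≤ F) → (∀ z, f z ≠ 0 → D ≤ (supDist x z : ℝ)) →
            (∀ w, w ∉ cubeT hPd (P.L ^ k) c (fun i => P.L ^ k * M i) → P.L ^ k ≤ supDist x w) →
            ‖covD P.eps⁻¹ (cfg U) (gBox (B1RG242Torus.α P a k * (P.L : ℝ) ^ (k * P.d)) P.eps⁻¹ U k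
                (cubeT hPd (P.L ^ k) c fun i => P.L ^ k * M i) *ᵥ f) ⟨x, μ⟩‖
              ≤ c₁ * P.spacing k * Real.exp (-(t₀ * D / (P.L : ℝ) ^ k)) * F := by
  classical
  obtain ⟨t₁, c_v, ht₁, hc_v, hval⟩ := decay110_smallField_cube d (L - 1) hd3 (by omega) ha
  obtain ⟨C_K, hCK, hker⟩ := BIJ85FlatPropagatorKernelDiffs.flat_kernel_diffs (d + 1) L (by omega) hL ha (le_refl (0 : ℝ))
  obtain ⟨C_L, hCL, hloc⟩ := local_gradient_bound (d + 1) (by omega) C_K hCK.le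
  -- the rate, the ball fraction and the constant
  set t : ℝ := min t₁ 1 with htdef
  have ht : 0 < t := lt_min ht₁ one_pos
  have ht1 : t ≤ 1 := min_le_right _ _
  have htt₁ : t ≤ t₁ := min_le_left _ _
  set e : ℝ := Real.exp 1 with hedef
  have he1 : 1 ≤ e := by rw [hedef]; exact Real.one_le_exp (by norm_num)
  have he0 : 0 < e := Real.exp_pos 1
  set cb : ℝ := min (1 / 8) (1 / (4 * (C_L * e + 1))) with hcbdef
  have hc0 : 0 < cb := lt_min (by norm_num) (by positivity)
  have hc8 : cb ≤ 1 / 8 := min_le_left _ _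
  have hc1 : cb ≤ 1 := hc8.trans (by norm_num)
  have hcC : C_L * e * cb ≤ 1 / 4 := by
    have h1 : cb ≤ 1 / (4 * (C_L * e + 1)) := min_le_right _ _
    have h2 : 0 ≤ C_L * e := by positivity
    calc C_L * e * cb ≤ C_L * e * (1 / (4 * (C_L * e + 1))) := mul_le_mul_of_nonneg_left h1 h2
      _ ≤ 1 / 4 := by rw [mul_one_div, div_le_iff₀ (by positivity)]; linarith
  set K₁ : ℝ := e * cb + c_v * e ^ 3 * (cb + 8 / cb + 2 * a) with hK₁
  have hK₁0 : 0 ≤ K₁ := by positivity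
  refine ⟨t, 2 * C_L * K₁ + 32 * e * c_v / cb + 1, ht, by positivity, ?_⟩
  intro P hPd hPL k hk1 hkK cc M hM hfit hN U θ T δ hθ0 hplaq hsmall hInt hTree hsmallT x μ f F D hF hsupp hdeep
  have hk : k ≤ P.m + P.K := hkK.trans (Nat.le_add_left _ _)
  have hPL' : P.L = L - 1 + 1 := by omega
  have hvalP := hval P hPd hPL' k hk1 hk cc M hM hfit hN U T δ hInt hTree hsmallT
  have hkerP := hker P hPd hPL k hk1 hkK
  set Q : Finset (Balaban1983to89.Site P 0) := cubeT hPd (P.L ^ k) cc fun i => P.L ^ k * M i with hQdef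
  -- basic quantities
  have hd1' : 1 ≤ P.d := by omega
  have hk0 : 0 + k ≤ P.m + P.K := by omega
  have hLpos : (0 : ℝ) < P.L := P.cast_L_pos
  have hL1 : (1 : ℝ) < P.L := B1RG242Torus.one_lt_cast_L P
  have hε : 0 < P.eps := P.eps_pos
  set n : ℝ := (P.L : ℝ) ^ k with hndef
  have hn : 0 < n := pow_pos hLpos k
  have hn1 : 1 ≤ n := one_le_pow₀ hL1.le
  have hncast : ((P.L ^ k : ℕ) : ℝ) = n := by rw [hndef]; push_cast; rfl
  have hn3 : 3 ≤ n := by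
    have h3 : 3 ≤ P.L := by
      obtain ⟨hodd, hlt⟩ := hL
      rw [hPL]
      rcases hodd with ⟨m, hm⟩
      omega
    have h3' : (3 : ℝ) ≤ P.L := by exact_mod_cast h3
    calc (3 : ℝ) = 3 ^ 1 := by norm_num
      _ ≤ (P.L : ℝ) ^ 1 := by gcongr
      _ ≤ (P.L : ℝ) ^ k := pow_le_pow_right₀ hL1.le hk1
  have hsp : P.spacing k = n * P.eps := rfl
  have hsp0 : 0 < P.spacing k := P.spacing_pos k
  have hα : 0 < B1RG242Torus.α P a k := mul_pos (B1.aSeq_pos ha hL1 hk1) (inv_pos.2 (pow_pos hsp0 2))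
  have hαa : B1RG242Torus.α P a k * P.spacing k ^ 2 ≤ a := by
    show B1.aSeq a P.L k * (P.spacing k ^ 2)⁻¹ * P.spacing k ^ 2 ≤ a
    rw [inv_mul_cancel_right₀ (pow_ne_zero 2 hsp0.ne')]
    exact B1.aSeq_le ha hL1 k hk1
  set a' : ℝ := B1RG242Torus.α P a k * (P.L : ℝ) ^ (k * P.d) with ha'def
  have ha' : 0 < a' := mul_pos hα (pow_pos hLpos _)
  have hc' : P.eps⁻¹ ≠ 0 := inv_ne_zero hε.ne'
  have hplaq' : ∀ p : Balaban1983to89.Plaq P 0, dist1 (GaugeField.plaqHol U p) ≤ θ := fun p => by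
    rw [BIJ88Smooth43Axial.dist1_eq_norm_toC_sub_one]; exact hplaq p
  have hF0 : 0 ≤ F := (norm_nonneg _).trans (hF x)
  have hΩ : IsBlockUnion k Q := isBlockUnion_cubeT hPd hk rfl hfit
  set φ := gBox a' P.eps⁻¹ U k Q *ᵥ f with hφ
  have hexpD : ∀ {D₁ D₂ : ℝ}, D₂ ≤ D₁ → Real.exp (-(t * D₁ / n)) ≤ Real.exp (-(t * D₂ / n)) := fun h =>
    Real.exp_le_exp.2 (by rw [neg_le_neg_iff]; exact div_le_div_of_nonneg_right (mul_le_mul_of_nonneg_left h ht.le) hn.le)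
  have hexp_t₁ : ∀ {D' : ℝ}, 0 ≤ D' → Real.exp (-(t₁ * D' / n)) ≤ Real.exp (-(t * D' / n)) := fun hD' =>
    Real.exp_le_exp.2 (by rw [neg_le_neg_iff]; exact div_le_div_of_nonneg_right (mul_le_mul_of_nonneg_right htt₁ hD') hn.le)
  -- the target, spelled out
  have hgoal : ‖covD P.eps⁻¹ (cfg U) φ ⟨x, μ⟩‖ = P.eps⁻¹ * ‖cfg U ⟨x, μ⟩ * φ (x.shift μ) - φ x‖ := by
    show ‖((P.eps⁻¹ : ℝ) : ℂ) * (cfg U ⟨x, μ⟩ * φ (x.shift μ) - φ x)‖ = _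
    rw [norm_mul, Complex.norm_real, Real.norm_of_nonneg (inv_nonneg.2 hε.le)]
  rw [hgoal]
  -- two values of `φ` bound a covariant difference: `‖u_bφ(b₊) − φ(b₋)‖ ≤ 2e·c_v·(L^kε)²e^{−tD_y/n}F` at any bond `⟨y, y+e_ν⟩` when `f`
  -- vanishes within `D_y` of `y`
  have htwo : ∀ (y : Balaban1983to89.Site P 0) (ν : Fin P.d) (Dy : ℝ), (∀ z, f z ≠ 0 → Dy ≤ (supDist y z : ℝ)) →
      ‖cfg U ⟨y, ν⟩ * φ (y.shift ν) - φ y‖ ≤ 2 * e * c_v * P.spacing k ^ 2 * Real.exp (-(t * Dy / n)) * F := by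
    intro y ν Dy hsy
    have hφy : ‖φ y‖ ≤ c_v * P.spacing k ^ 2 * Real.exp (-(t * Dy / n)) * F := by
      have h1 := hvalP y f F (max Dy 0) hF (fun z hz => max_le (hsy z hz) (Nat.cast_nonneg _))
      refine h1.trans ?_
      have h2 : Real.exp (-(t₁ * max Dy 0 / n)) ≤ Real.exp (-(t * Dy / n)) := (hexp_t₁ (le_max_right _ _)).trans (hexpD (le_max_left _ _))
      gcongr
    have hφy' : ‖φ (y.shift ν)‖ ≤ c_v * P.spacing k ^ 2 * (e * Real.exp (-(t * Dy / n))) * F := by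
      have h1 := hvalP (y.shift ν) f F (max (Dy - 1) 0) hF (fun z hz => ?_)
      · refine h1.trans ?_
        have h2 : Real.exp (-(t₁ * max (Dy - 1) 0 / n)) ≤ e * Real.exp (-(t * Dy / n)) := by
          refine ((hexp_t₁ (le_max_right _ _)).trans (hexpD (le_max_left _ _))).trans ?_
          rw [hedef, ← Real.exp_add]
          refine Real.exp_le_exp.2 ?_
          rw [show -(t * (Dy - 1) / n) = -(t * Dy / n) + t / n by ring]
          have : t / n ≤ 1 := by rw [div_le_one hn]; exact ht1.trans hn1
          linarith only [this]
        gcongr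
      · have h3 := hsy z hz
        have h4 : supDist y z ≤ supDist y (y.shift ν) + supDist (y.shift ν) z := supDist_triangle y (y.shift ν) z
        have h5 := supDist_shift_le_one' y ν
        have h6 : (supDist y z : ℝ) ≤ 1 + supDist (y.shift ν) z := by
          have : ((supDist y z : ℕ) : ℝ) ≤ ((supDist y (y.shift ν) + supDist (y.shift ν) z : ℕ) : ℝ) := by exact_mod_cast h4
          have h5' : ((supDist y (y.shift ν) : ℕ) : ℝ) ≤ 1 := by exact_mod_cast h5
          push_cast at this; linarith only [this, h5']
        exact max_le (by linarith only [h3, h6]) (Nat.cast_nonneg _)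
    refine (norm_sub_le _ _).trans ?_
    rw [norm_mul, show ‖cfg U ⟨y, ν⟩‖ = 1 from norm_toC _, one_mul]
    have hE : 0 ≤ Real.exp (-(t * Dy / n)) := (Real.exp_pos _).le
    have e1x : c_v * P.spacing k ^ 2 * Real.exp (-(t * Dy / n)) * F ≤ c_v * P.spacing k ^ 2 * (e * Real.exp (-(t * Dy / n))) * F := by
      have : Real.exp (-(t * Dy / n)) ≤ e * Real.exp (-(t * Dy / n)) := le_mul_of_one_le_left hE he1
      gcongr
    linarith only [hφy, hφy', e1x]
  -- the radius of record of the interior estimate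
  set rm : ℕ := ⌊cb * n⌋₊ with hrmdef
  have hrmc : (rm : ℝ) ≤ cb * n := Nat.floor_le (by positivity)
  by_cases hrm4 : rm < 4
  · ----------------------------------------------------------------------------------------------------------------
    -- SMALL CASE `cb·L^k < 4`: the trivial bound by two values of `φ`
    have hn4 : n < 4 / cb := by
      have h1 : cb * n < rm + 1 := Nat.lt_floor_add_one _
      have h2 : (rm : ℝ) + 1 ≤ 4 := by exact_mod_cast hrm4
      rw [lt_div_iff₀ hc0]; linarith only [h1, h2]
    have hδ := htwo x μ D hsupp
    have hcoef : 2 * e * c_v * n ≤ 32 * e * c_v / cb := by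
      rw [show 32 * e * c_v / cb = 2 * e * c_v * (16 / cb) by ring]
      refine mul_le_mul_of_nonneg_left ?_ (by positivity)
      have : 4 / cb ≤ 16 / cb := div_le_div_of_nonneg_right (by norm_num) hc0.le
      linarith only [this, hn4]
    calc P.eps⁻¹ * ‖cfg U ⟨x, μ⟩ * φ (x.shift μ) - φ x‖ ≤ P.eps⁻¹ * (2 * e * c_v * P.spacing k ^ 2 * Real.exp (-(t * D / n)) * F) :=
          mul_le_mul_of_nonneg_left hδ (inv_nonneg.2 hε.le)
      _ = (2 * e * c_v * n) * P.spacing k * Real.exp (-(t * D / n)) * F := by rw [hsp]; field_simp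
      _ ≤ (32 * e * c_v / cb) * P.spacing k * Real.exp (-(t * D / n)) * F := by gcongr
      _ ≤ _ := mul_le_mul_of_nonneg_right (mul_le_mul_of_nonneg_right (mul_le_mul_of_nonneg_right
          (by linarith only [show (0 : ℝ) ≤ 2 * C_L * K₁ by positivity]) hsp0.le) (Real.exp_pos _).le) hF0
  ----------------------------------------------------------------------------------------------------------------
  -- MAIN CASE `rm = ⌊cb·L^k⌋ ≥ 4`
  push Not at hrm4
  have hrm0 : (0 : ℝ) < rm := by exact_mod_cast (show 0 < rm by omega)
  have hcn4 : 4 ≤ cb * n := le_trans (by exact_mod_cast hrm4) hrmc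
  have hrm2 : cb * n / 2 ≤ rm := by have h1 : cb * n < rm + 1 := Nat.lt_floor_add_one _; linarith only [h1, hcn4]
  have hrmn : (rm : ℝ) ≤ n / 8 := hrmc.trans (by have := mul_le_mul_of_nonneg_right hc8 hn.le; linarith only [this])
  -- the trivial sub-case `f = 0`
  by_cases hf0 : ∀ z, f z = 0
  · have hφ0 : φ = 0 := by rw [hφ, show f = 0 from funext hf0, mulVec_zero]
    rw [hφ0]; simp only [Pi.zero_apply, mul_zero, sub_zero, norm_zero, mul_zero]
    positivity
  push Not at hf0
  -- the distance to the support
  set supp : Finset (Balaban1983to89.Site P 0) := univ.filter fun w => f w ≠ 0 with hsuppdef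
  have hne : supp.Nonempty := by obtain ⟨w, hw⟩ := hf0; exact ⟨w, by rw [hsuppdef, mem_filter]; exact ⟨mem_univ _, hw⟩⟩
  have hmem : ∀ {w}, f w ≠ 0 → w ∈ supp := fun hw => by rw [hsuppdef, mem_filter]; exact ⟨mem_univ _, hw⟩
  set Df : Balaban1983to89.Site P 0 → ℕ := fun z => supp.inf' hne fun w => supDist z w with hDf
  have hDf_le : ∀ z w, f w ≠ 0 → Df z ≤ supDist z w := fun z w hw => Finset.inf'_le _ (hmem hw)
  have hDf_ex : ∀ z, ∃ w, f w ≠ 0 ∧ Df z = supDist z w := fun z => by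
    obtain ⟨w, hw, h⟩ := Finset.exists_mem_eq_inf' hne (fun w => supDist z w)
    rw [hsuppdef, mem_filter] at hw
    exact ⟨w, hw.2, h⟩
  have hDf_tri : ∀ y z, Df y ≤ supDist y z + Df z := fun y z => by
    obtain ⟨w, hw, h⟩ := hDf_ex z
    rw [h]
    exact (hDf_le y w hw).trans (supDist_triangle y z w)
  -- the depth in the cube (distance to the complement; `L^k` if the complement is empty)
  set Qc : Finset (Balaban1983to89.Site P 0) := univ.filter fun w => w ∉ Q with hQcdef
  set dep : Balaban1983to89.Site P 0 → ℕ := fun z => if hq : Qc.Nonempty then Qc.inf' hq (fun w => supDist z w) else P.L ^ k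
    with hdepdef
  have hdep_app : ∀ z, dep z = if hq : Qc.Nonempty then Qc.inf' hq (fun w => supDist z w) else P.L ^ k := fun z => rfl
  have hdep_le : ∀ z w, w ∉ Q → dep z ≤ supDist z w := by
    intro z w hw
    have hwQc : w ∈ Qc := by rw [hQcdef, mem_filter]; exact ⟨mem_univ _, hw⟩
    have hq : Qc.Nonempty := ⟨w, hwQc⟩
    rw [hdep_app, dif_pos hq]
    exact Finset.inf'_le _ hwQc
  have hdep_in : ∀ z w, supDist z w < dep z → w ∈ Q := fun z w h => by
    by_contra hw
    exact absurd (hdep_le z w hw) (not_le.2 h)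
  have hdep_tri : ∀ y z, dep y ≤ supDist y z + dep z := by
    intro y z
    by_cases hq : Qc.Nonempty
    · obtain ⟨w, hw, h⟩ := Finset.exists_mem_eq_inf' hq (fun w => supDist z w)
      have hwQ : w ∉ Q := by rw [hQcdef, mem_filter] at hw; exact hw.2
      have h1 : dep z = supDist z w := by rw [hdep_app, dif_pos hq]; exact h
      rw [h1]
      exact (hdep_le y w hwQ).trans (supDist_triangle y z w)
    · rw [hdep_app y, hdep_app z, dif_neg hq, dif_neg hq]; omega
  have hdep_x : (n : ℝ) ≤ dep x := by
    rw [← hncast]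
    have h1 : P.L ^ k ≤ dep x := by
      by_cases hq : Qc.Nonempty
      · rw [hdep_app, dif_pos hq]
        refine Finset.le_inf' _ _ fun w hw => hdeep w ?_
        rw [hQcdef, mem_filter] at hw; exact hw.2
      · rw [hdep_app, dif_neg hq]
    exact_mod_cast h1
  -- the admissible half-radius `ρ(z) = (depth − 2)/2` and the depth weight `W(z) = min(rm, max(0, ρ))/rm`
  set ρf : Balaban1983to89.Site P 0 → ℝ := fun z => ((dep z : ℝ) - 2) / 2 with hρfdef
  have hρf_app : ∀ z, ρf z = ((dep z : ℝ) - 2) / 2 := fun z => rfl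
  set W : Balaban1983to89.Site P 0 → ℝ := fun z => min (rm : ℝ) (max 0 (ρf z)) / rm with hWdef
  have hW_app : ∀ z, W z = min (rm : ℝ) (max 0 (ρf z)) / rm := fun z => rfl
  have hW01 : ∀ z, 0 ≤ W z ∧ W z ≤ 1 := fun z => by rw [hW_app]; exact weight_mem hrm0
  -- the weighted maximum over bonds
  set g : PBond P 0 → ℝ := fun b => W b.src * (Real.exp (t * Df b.src / n) * ‖cfg U b * φ b.tgt - φ b.src‖) with hgdef
  have hg_app : ∀ (z : Balaban1983to89.Site P 0) (ν : Fin P.d),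
      g ⟨z, ν⟩ = W z * (Real.exp (t * Df z / n) * ‖cfg U ⟨z, ν⟩ * φ (z.shift ν) - φ z‖) := fun z ν => rfl
  obtain ⟨b₀, -, hb₀⟩ := exists_max_image (univ : Finset (PBond P 0)) g ⟨⟨x, μ⟩, mem_univ _⟩
  obtain ⟨y₀, μ₀⟩ := b₀
  set Mx : ℝ := g ⟨y₀, μ₀⟩ with hMxdef
  have hMb : ∀ (z : Balaban1983to89.Site P 0) (ν : Fin P.d), g ⟨z, ν⟩ ≤ Mx := fun z ν => hb₀ ⟨z, ν⟩ (mem_univ _)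
  have hMxeq : Mx = W y₀ * (Real.exp (t * Df y₀ / n) * ‖cfg U ⟨y₀, μ₀⟩ * φ (y₀.shift μ₀) - φ y₀‖) := by rw [hMxdef, hg_app]
  have hM0 : 0 ≤ Mx := by rw [hMxeq]; exact mul_nonneg (hW01 _).1 (by positivity)
  -- how the weighted maximum controls a covariant difference
  have hMuse : ∀ (z : Balaban1983to89.Site P 0) (ν : Fin P.d),
      W z * ‖cfg U ⟨z, ν⟩ * φ (z.shift ν) - φ z‖ ≤ Mx * Real.exp (-(t * Df z / n)) := by
    intro z ν
    have h1 := hMb z ν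
    rw [hg_app] at h1
    have h2 : Real.exp (t * Df z / n) * Real.exp (-(t * Df z / n)) = 1 := by rw [← Real.exp_add, add_neg_cancel, Real.exp_zero]
    calc W z * ‖cfg U ⟨z, ν⟩ * φ (z.shift ν) - φ z‖
        = W z * ‖cfg U ⟨z, ν⟩ * φ (z.shift ν) - φ z‖ * (Real.exp (t * Df z / n) * Real.exp (-(t * Df z / n))) := by
          rw [h2, mul_one]
      _ = (W z * (Real.exp (t * Df z / n) * ‖cfg U ⟨z, ν⟩ * φ (z.shift ν) - φ z‖)) * Real.exp (-(t * Df z / n)) := by ring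
      _ ≤ Mx * Real.exp (-(t * Df z / n)) := mul_le_mul_of_nonneg_right h1 (Real.exp_pos _).le
  -- REDUCTION: it suffices to bound the weighted maximum, `Mx ≤ C·L^kε²F`, since the weight of the target bond is `1`
  have hWx : W x = 1 := by
    have hρx : (rm : ℝ) ≤ ρf x := by
      rw [hρf_app, le_div_iff₀ (by norm_num : (0:ℝ) < 2)]
      linarith only [hdep_x, hrmn, hn3]
    rw [hW_app, max_eq_right (hrm0.le.trans hρx), min_eq_left hρx, div_self hrm0.ne']
  have hDx : D ≤ (Df x : ℝ) := by
    obtain ⟨w, hw, h⟩ := hDf_ex x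
    rw [h]; exact hsupp w hw
  suffices hMfin : Mx ≤ (2 * C_L * K₁ + 32 * e * c_v / cb) * (n * P.eps ^ 2 * F) by
    have hδx : ‖cfg U ⟨x, μ⟩ * φ (x.shift μ) - φ x‖ ≤
        (2 * C_L * K₁ + 32 * e * c_v / cb) * (n * P.eps ^ 2 * F) * Real.exp (-(t * D / n)) := by
      have h1 := hMuse x μ
      rw [hWx, one_mul] at h1
      exact h1.trans (mul_le_mul hMfin (hexpD hDx) (Real.exp_pos _).le (by positivity))
    calc P.eps⁻¹ * ‖cfg U ⟨x, μ⟩ * φ (x.shift μ) - φ x‖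
        ≤ P.eps⁻¹ * ((2 * C_L * K₁ + 32 * e * c_v / cb) * (n * P.eps ^ 2 * F) * Real.exp (-(t * D / n))) :=
          mul_le_mul_of_nonneg_left hδx (inv_nonneg.2 hε.le)
      _ = (2 * C_L * K₁ + 32 * e * c_v / cb) * P.spacing k * Real.exp (-(t * D / n)) * F := by rw [hsp]; field_simp
      _ ≤ _ := mul_le_mul_of_nonneg_right (mul_le_mul_of_nonneg_right (mul_le_mul_of_nonneg_right (lt_add_one _).le hsp0.le)
          (Real.exp_pos _).le) hF0
  ----------------------------------------------------------------------------------------------------------------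
  -- THE BOUND ON THE WEIGHTED MAXIMUM, at the maximal bond `⟨y₀, y₀ + e_{μ₀}⟩`
  set D₀ : ℝ := (Df y₀ : ℝ) with hD₀
  set E : ℝ := Real.exp (-(t * D₀ / n)) with hEdef
  have hE0 : 0 < E := Real.exp_pos _
  have hEinv : Real.exp (t * D₀ / n) * E = 1 := by rw [hEdef, ← Real.exp_add, add_neg_cancel, Real.exp_zero]
  set W₀ : ℝ := W y₀ with hW₀def
  have hW₀_app : W₀ = min (rm : ℝ) (max 0 (ρf y₀)) / rm := hW_app y₀
  set ρ₀ : ℝ := ρf y₀ with hρ₀def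
  have hρ₀_app : ρ₀ = ((dep y₀ : ℝ) - 2) / 2 := hρf_app y₀
  by_cases hρ8 : ρ₀ < 8
  · ----------------------------------------------------------------------------------------------------------------
    -- SHALLOW MAXIMAL BOND (depth `< 18`): weight `< 8/rm ≤ 16/(cb·n)`, two values of `φ`
    have hW₀le : W₀ ≤ 8 / rm := by
      rw [hW₀_app]
      refine div_le_div_of_nonneg_right ((min_le_right _ _).trans (max_le (by norm_num) hρ8.le)) hrm0.le
    have hδ₀ := htwo y₀ μ₀ D₀ (fun z hz => by rw [hD₀]; exact_mod_cast hDf_le y₀ z hz)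
    have h1 : Mx ≤ (8 / rm) * (2 * e * c_v * P.spacing k ^ 2 * F) := by
      rw [hMxeq]
      have h2 : Real.exp (t * D₀ / n) * ‖cfg U ⟨y₀, μ₀⟩ * φ (y₀.shift μ₀) - φ y₀‖ ≤ 2 * e * c_v * P.spacing k ^ 2 * F := by
        calc Real.exp (t * D₀ / n) * ‖cfg U ⟨y₀, μ₀⟩ * φ (y₀.shift μ₀) - φ y₀‖
            ≤ Real.exp (t * D₀ / n) * (2 * e * c_v * P.spacing k ^ 2 * Real.exp (-(t * D₀ / n)) * F) :=
              mul_le_mul_of_nonneg_left hδ₀ (Real.exp_pos _).le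
          _ = 2 * e * c_v * P.spacing k ^ 2 * F * (Real.exp (t * D₀ / n) * E) := by rw [hEdef]; ring
          _ = 2 * e * c_v * P.spacing k ^ 2 * F := by rw [hEinv, mul_one]
      exact mul_le_mul hW₀le h2 (by positivity) (by positivity)
    have h3 := shallow_step (sp := P.spacing k) hrm0 hc0 hn he0.le hc_v.le hF0 hrm2 hsp
    have h6 : 0 ≤ 2 * C_L * K₁ * (n * P.eps ^ 2 * F) := by positivity
    linarith only [h1, h3, h6]
  ----------------------------------------------------------------------------------------------------------------
  -- DEEP MAXIMAL BOND (`ρ₀ ≥ 8`): the interior estimate on the ball of half the admissible radius, and absorption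
  push Not at hρ8
  have hρ₀0 : 0 ≤ ρ₀ := by linarith only [hρ8]
  have hW₀pos : 0 < W₀ := by
    rw [hW₀_app]
    exact div_pos (lt_min hrm0 (lt_max_of_lt_right (by linarith only [hρ8]))) hrm0
  have hW₀1 : W₀ ≤ 1 := (hW01 y₀).2
  have hdep₀ : (18 : ℝ) ≤ dep y₀ := by linarith only [hρ8, hρ₀_app]
  -- the working radius `r = min(rm, ⌊ρ₀/2⌋)`
  set r : ℕ := min rm ⌊ρ₀ / 2⌋₊ with hrdef
  have hfl : (⌊ρ₀ / 2⌋₊ : ℝ) ≤ ρ₀ / 2 := Nat.floor_le (by positivity)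
  have hfl' : ρ₀ / 2 - 1 ≤ (⌊ρ₀ / 2⌋₊ : ℝ) := by have := Nat.lt_floor_add_one (ρ₀ / 2); linarith only [this]
  have hfl4 : 4 ≤ ⌊ρ₀ / 2⌋₊ := Nat.le_floor (by push_cast; linarith only [hρ8])
  have hr4 : 4 ≤ r := le_min hrm4 hfl4
  have hr0 : (0 : ℝ) < r := by exact_mod_cast (show 0 < r by omega)
  have hrrm : r ≤ rm := min_le_left _ _
  have hrrmR : (r : ℝ) ≤ rm := by exact_mod_cast hrrm
  have hrc : (r : ℝ) ≤ cb * n := hrrmR.trans hrmc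
  have hrn : (r : ℝ) ≤ n / 8 := hrrmR.trans hrmn
  have hrρ : (r : ℝ) ≤ ρ₀ / 2 := by
    have h1 : (r : ℝ) ≤ (⌊ρ₀ / 2⌋₊ : ℝ) := by exact_mod_cast (min_le_right _ _ : r ≤ ⌊ρ₀ / 2⌋₊)
    exact h1.trans hfl
  have hrlow : min (rm : ℝ) ρ₀ / 4 ≤ r := by
    have h1 : ((r : ℕ) : ℝ) = min (rm : ℝ) (⌊ρ₀ / 2⌋₊ : ℝ) := by rw [hrdef]; push_cast; rfl
    rw [h1]
    exact (min_div_four_le hrm0.le (by linarith only [hρ8])).trans (min_le_min le_rfl hfl')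
  have hN : 4 * r + 6 ≤ P.sitesPerDir 0 := by
    have h1 := two_mul_pow_le_sitesPerDir (P := P) hk
    have h2 : 8 * (r : ℝ) ≤ (P.L ^ k : ℕ) := by rw [hncast]; linarith only [hrn]
    have h3 : 8 * r ≤ P.L ^ k := by exact_mod_cast h2
    omega
  -- every site within `2r + 1` of `y₀` lies in the cube
  have hball : ∀ z, supDist y₀ z ≤ 2 * r + 1 → z ∈ Q := by
    intro z hz
    refine hdep_in y₀ z ?_
    have h1 : ((supDist y₀ z : ℕ) : ℝ) ≤ 2 * r + 1 := by exact_mod_cast hz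
    have h2 : (2 * r + 1 : ℝ) < dep y₀ := by linarith only [hrρ, hdep₀, hρ₀_app]
    exact_mod_cast h1.trans_lt h2
  -- the depth weight on the `2r`-ball is at least `W₀/2`
  have hWball : ∀ z, supDist y₀ z ≤ 2 * r → W₀ / 2 ≤ W z := by
    intro z hz
    have h1 : ((supDist y₀ z : ℕ) : ℝ) ≤ 2 * r := by exact_mod_cast hz
    have h2 : ((dep y₀ : ℕ) : ℝ) ≤ supDist y₀ z + dep z := by exact_mod_cast hdep_tri y₀ z
    have h3 : ρ₀ / 2 ≤ ρf z := by rw [hρf_app]; linarith only [h1, h2, hrρ, hρ₀_app]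
    have h4 : min (rm : ℝ) (max 0 ρ₀) / 2 ≤ min (rm : ℝ) (max 0 (ρf z)) := by
      refine (min_div_two_le hrm0.le).trans (min_le_min le_rfl ?_)
      rw [max_eq_right hρ₀0]
      exact le_max_of_le_right h3
    rw [hW₀_app, hW_app, div_div, div_le_div_iff₀ (by positivity) hrm0]
    have h5 := mul_le_mul_of_nonneg_right h4 (by positivity : (0:ℝ) ≤ (rm : ℝ) * 2)
    linarith only [h5]
  -- the local exponential slack factors
  have hslack1 : Real.exp (t * (2 * r) / n) ≤ e := by
    rw [hedef]; refine Real.exp_le_exp.2 ?_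
    rw [div_le_one hn]
    have h1 : t * (2 * r) ≤ 1 * (2 * r) := mul_le_mul_of_nonneg_right ht1 (by positivity)
    linarith only [h1, hrn]
  have hslack3 : Real.exp (t * (2 * r + n + 1) / n) ≤ e ^ 3 := by
    rw [hedef, ← Real.exp_nat_mul]; refine Real.exp_le_exp.2 ?_
    rw [div_le_iff₀ hn]
    have h1 : t * (2 * r + n + 1) ≤ 1 * (2 * r + n + 1) := mul_le_mul_of_nonneg_right ht1 (by positivity)
    push_cast
    linarith only [h1, hrn, hn1]
  -- the gauge, the gauge copy, its source in the TORUS problem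
  set hg := BIJ85CentredAxialGauge.centredGauge U y₀ (2 * r) with hhg
  set U' := GaugeField.gaugeAct hg U with hU'
  set ψ : Balaban1983to89.Site P 0 → ℂ := fun z => toC (hg z) * φ z with hψdef
  set f' : Balaban1983to89.Site P 0 → ℂ := nOp a' P.eps⁻¹ U' k univ *ᵥ ψ with hf'def
  have hψeq : nOp a' P.eps⁻¹ U' k univ *ᵥ ψ = f' := rfl
  have hnormψ : ∀ z, ‖ψ z‖ = ‖φ z‖ := fun z => by rw [show ψ z = toC (hg z) * φ z from rfl, norm_mul, norm_toC, one_mul]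
  have hcov : ∀ z ν, ‖cfg U' ⟨z, ν⟩ * ψ (z.shift ν) - ψ z‖ = ‖cfg U ⟨z, ν⟩ * φ (z.shift ν) - φ z‖ := fun z ν =>
    norm_covDiff_gaugeAct hg U φ z ν
  -- the source of the torus problem agrees with `h·f` on the `2r`-ball (its bonds lie in the cube)
  have hf'eq : ∀ z, supDist y₀ z ≤ 2 * r → f' z = toC (hg z) * f z := by
    intro z hz
    have hzQ : z ∈ Q := hball z (by omega)
    have hsQ : ∀ ν, z.shift ν ∈ Q := fun ν => hball _ ((supDist_shift_le_succ y₀ z ν).trans (by omega))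
    have huQ : ∀ ν, z.unshift ν ∈ Q := fun ν => hball _ ((supDist_unshift_le_succ y₀ z ν).trans (by omega))
    rw [← hψeq, nOp_univ_mulVec_apply_eq_of_interior a' P.eps⁻¹ U' hΩ ψ hzQ hsQ huQ]
    exact nOp_gaugeAct_mulVec_apply hk0 hc' ha' hg U hΩ f hzQ
  set γ : ℝ := ((P.d - 1 : ℕ) : ℝ) * θ with hγdef
  have hγ0 : 0 ≤ γ := by positivity
  have hγn : γ * n ^ 2 ≤ 1 := gamma_nsq_le_one hθ0 hd1' hsmall
  have hgauge : ∀ z ν, supDist y₀ z ≤ 2 * r → ‖cfg U' ⟨z, ν⟩ - 1‖ ≤ γ * supDist y₀ z := by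
    intro z ν hz
    have hR : 2 * (2 * r) + 4 < P.sitesPerDir 0 := by omega
    have h1 := BIJ85CentredAxialGauge.dist1_centredGauge_le U hθ0 hplaq' y₀ hR z hz ν
    rw [BIJ88Smooth43Axial.dist1_eq_norm_toC_sub_one] at h1
    calc ‖cfg U' ⟨z, ν⟩ - 1‖ = ‖toC (GaugeField.gaugeAct hg U ⟨z, ν⟩) - 1‖ := rfl
      _ ≤ ((P.d - 1 : ℕ) : ℝ) * (supDist y₀ z : ℝ) * θ := h1
      _ = γ * supDist y₀ z := by rw [hγdef]; ring
  -- the local data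
  set S₀ : ℝ := c_v * P.spacing k ^ 2 * F * e ^ 3 with hS₀def
  set S : ℝ := S₀ * E with hSdef
  have hS0 : 0 ≤ S := by positivity
  have hSψ : ∀ z, supDist y₀ z ≤ 2 * r + P.L ^ k + 1 → ‖ψ z‖ ≤ S := by
    intro z hz
    rw [hnormψ]
    have hsup : ∀ w, f w ≠ 0 → max (D₀ - supDist y₀ z) 0 ≤ (supDist z w : ℝ) := fun w hw => by
      refine max_le ?_ (Nat.cast_nonneg _)
      have h1 := (hDf_le y₀ w hw).trans (supDist_triangle y₀ z w)
      have : ((Df y₀ : ℕ) : ℝ) ≤ ((supDist y₀ z + supDist z w : ℕ) : ℝ) := by exact_mod_cast h1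
      push_cast at this; rw [hD₀]; linarith only [this]
    refine (hvalP z f F _ hF hsup).trans ?_
    have h2 : Real.exp (-(t₁ * max (D₀ - supDist y₀ z) 0 / n)) ≤ E * e ^ 3 := by
      refine ((hexp_t₁ (le_max_right _ _)).trans (hexpD (le_max_left _ _))).trans ?_
      have hz' : (supDist y₀ z : ℝ) ≤ 2 * r + n + 1 := by
        have : ((supDist y₀ z : ℕ) : ℝ) ≤ ((2 * r + P.L ^ k + 1 : ℕ) : ℝ) := by exact_mod_cast hz
        push_cast at this; rw [hndef]; exact this
      calc Real.exp (-(t * (D₀ - supDist y₀ z) / n)) = E * Real.exp (t * supDist y₀ z / n) := by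
            rw [hEdef, ← Real.exp_add]; congr 1; ring
        _ ≤ E * Real.exp (t * (2 * r + n + 1) / n) := by
            refine mul_le_mul_of_nonneg_left (Real.exp_le_exp.2 ?_) hE0.le
            exact div_le_div_of_nonneg_right (mul_le_mul_of_nonneg_left hz' ht.le) hn.le
        _ ≤ E * e ^ 3 := mul_le_mul_of_nonneg_left hslack3 hE0.le
    calc c_v * P.spacing k ^ 2 * Real.exp (-(t₁ * max (D₀ - ↑(supDist y₀ z)) 0 / n)) * F
        ≤ c_v * P.spacing k ^ 2 * (E * e ^ 3) * F := by gcongr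
      _ = S := by rw [hSdef, hS₀def]; ring
  set Mloc : ℝ := 2 * Mx * E * e / W₀ with hMlocdef
  have hMloc0 : 0 ≤ Mloc := by positivity
  have hMψ : ∀ z ν, supDist y₀ z ≤ 2 * r → ‖cfg U' ⟨z, ν⟩ * ψ (z.shift ν) - ψ z‖ ≤ Mloc := by
    intro z ν hz
    rw [hcov]
    have hWz : W₀ / 2 ≤ W z := hWball z hz
    have hWz0 : 0 < W z := lt_of_lt_of_le (by positivity) hWz
    have h1 : Real.exp (-(t * Df z / n)) ≤ E * e := by
      have h2 : (D₀ - 2 * r : ℝ) ≤ Df z := by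
        have h3 : ((Df y₀ : ℕ) : ℝ) ≤ ((supDist y₀ z + Df z : ℕ) : ℝ) := by exact_mod_cast hDf_tri y₀ z
        have h4 : ((supDist y₀ z : ℕ) : ℝ) ≤ ((2 * r : ℕ) : ℝ) := by exact_mod_cast hz
        push_cast at h3 h4; rw [hD₀]; linarith only [h3, h4]
      refine (hexpD h2).trans ?_
      calc Real.exp (-(t * (D₀ - 2 * r) / n)) = E * Real.exp (t * (2 * r) / n) := by rw [hEdef, ← Real.exp_add]; congr 1; ring
        _ ≤ E * e := mul_le_mul_of_nonneg_left hslack1 hE0.le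
    have h5 : W z * ‖cfg U ⟨z, ν⟩ * φ (z.shift ν) - φ z‖ ≤ Mx * (E * e) := (hMuse z ν).trans (mul_le_mul_of_nonneg_left h1 hM0)
    rw [← le_div_iff₀' hWz0] at h5
    refine h5.trans ?_
    rw [hMlocdef, div_le_div_iff₀ hWz0 hW₀pos]
    have h6 : 0 ≤ Mx * (E * e) := by positivity
    have h7 : Mx * (E * e) * (W₀ / 2) ≤ Mx * (E * e) * W z := mul_le_mul_of_nonneg_left hWz h6
    linarith only [h7]
  set Floc : ℝ := F * E * e with hFlocdef
  have hFloc0 : 0 ≤ Floc := by positivity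
  have hFf' : ∀ z, supDist y₀ z ≤ 2 * r → ‖f' z‖ ≤ Floc := by
    intro z hz
    rw [hf'eq z hz, norm_mul, norm_toC, one_mul]
    by_cases hfz : f z = 0
    · rw [hfz, norm_zero]; exact hFloc0
    · have h1 : D₀ ≤ 2 * r := by
        have := (hDf_le y₀ z hfz).trans hz
        have h2 : ((Df y₀ : ℕ) : ℝ) ≤ ((2 * r : ℕ) : ℝ) := by exact_mod_cast this
        push_cast at h2; rw [hD₀]; exact h2
      have h2 : 1 ≤ E * e := by
        have h3 : Real.exp (-(t * (2 * r) / n)) ≤ E := hexpD h1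
        have h4 : Real.exp (-(t * (2 * r) / n)) * Real.exp (t * (2 * r) / n) = 1 := by
          rw [← Real.exp_add, neg_add_cancel, Real.exp_zero]
        calc (1 : ℝ) = Real.exp (-(t * (2 * r) / n)) * Real.exp (t * (2 * r) / n) := h4.symm
          _ ≤ E * e := mul_le_mul h3 hslack1 (Real.exp_pos _).le hE0.le
      calc ‖f z‖ ≤ F := hF z
        _ = F * 1 := (mul_one F).symm
        _ ≤ F * (E * e) := mul_le_mul_of_nonneg_left h2 hF0
        _ = Floc := by rw [hFlocdef]; ring
  -- THE LOCAL ESTIMATE (flat kernel envelopes in the torus dimension `P.d = d + 1`)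
  have hK1 : ∀ z, |(B1RG242Torus.tower P a 0).G k (y₀.shift μ₀) z - (B1RG242Torus.tower P a 0).G k y₀ z| ≤
      C_K * P.eps ^ 2 / (max (supDist y₀ z : ℝ) 1) ^ (P.d - 1) := fun z => by
    rw [hPd, Nat.add_sub_cancel]
    have h := hkerP.1 μ₀ y₀ z
    rwa [Nat.add_sub_cancel] at h
  have hK2 : ∀ (ν : Fin P.d) z, |(B1RG242Torus.tower P a 0).G k (y₀.shift μ₀) (z.shift ν) -
      (B1RG242Torus.tower P a 0).G k (y₀.shift μ₀) z - (B1RG242Torus.tower P a 0).G k y₀ (z.shift ν) +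
      (B1RG242Torus.tower P a 0).G k y₀ z| ≤ C_K * P.eps ^ 2 / (max (supDist y₀ z : ℝ) 1) ^ P.d := fun ν z => by
    rw [hPd]
    exact hkerP.2 μ₀ ν y₀ z
  have hmain := hloc P hPd ha hk1 hkK hr4 hN y₀ μ₀ U' ψ f' hψeq hγ0 hS0 hMloc0 hFloc0 hK1 hK2 hgauge hSψ hMψ hFf'
  -- its left-hand side is `Mx·E/W₀`
  have hLHS : ‖ψ (y₀.shift μ₀) - ψ y₀‖ = Mx * E / W₀ := by
    have hu1 : cfg U' ⟨y₀, μ₀⟩ = 1 := by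
      have h1 := hgauge y₀ μ₀ (by rw [(supDist_eq_zero_iff y₀ y₀).2 rfl]; exact Nat.zero_le _)
      rw [(supDist_eq_zero_iff y₀ y₀).2 rfl, Nat.cast_zero, mul_zero] at h1
      exact sub_eq_zero.1 (norm_le_zero_iff.1 h1)
    have h2 : ‖ψ (y₀.shift μ₀) - ψ y₀‖ = ‖cfg U ⟨y₀, μ₀⟩ * φ (y₀.shift μ₀) - φ y₀‖ := by rw [← hcov, hu1, one_mul]
    rw [h2, eq_div_iff hW₀pos.ne', hMxeq]
    calc ‖cfg U ⟨y₀, μ₀⟩ * φ (y₀.shift μ₀) - φ y₀‖ * W₀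
        = W₀ * (‖cfg U ⟨y₀, μ₀⟩ * φ (y₀.shift μ₀) - φ y₀‖ * (Real.exp (t * D₀ / n) * E)) := by rw [hEinv]; ring
      _ = W₀ * (Real.exp (t * D₀ / n) * ‖cfg U ⟨y₀, μ₀⟩ * φ (y₀.shift μ₀) - φ y₀‖) * E := by ring
  rw [hLHS] at hmain
  -- `γ r² ≤ cb²`, the contraction factor `2·C_L·e·γ r² ≤ 1/2`
  have hγr : γ * (r : ℝ) ^ 2 ≤ cb ^ 2 := by
    calc γ * (r : ℝ) ^ 2 ≤ γ * (cb * n) ^ 2 := mul_le_mul_of_nonneg_left (pow_le_pow_left₀ hr0.le hrc 2) hγ0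
      _ = cb ^ 2 * (γ * n ^ 2) := by ring
      _ ≤ cb ^ 2 * 1 := mul_le_mul_of_nonneg_left hγn (sq_nonneg cb)
      _ = cb ^ 2 := mul_one _
  have hκ : C_L * (γ * (r : ℝ) ^ 2) * (2 * e) ≤ 1 / 2 := by
    calc C_L * (γ * (r : ℝ) ^ 2) * (2 * e) ≤ C_L * cb ^ 2 * (2 * e) := by gcongr
      _ = 2 * ((C_L * e * cb) * cb) := by ring
      _ ≤ 2 * ((1 / 4) * 1) := by
          refine mul_le_mul_of_nonneg_left (mul_le_mul hcC hc1 hc0.le (by norm_num)) (by norm_num)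
      _ = 1 / 2 := by norm_num
  -- absorb: `Mx ≤ 2·C_L·W₀·(F e ε² r + (γ r + 1/r + α ε²(r + n))·S₀)`
  have hmain' : Mx * E / W₀ ≤ C_L * ((F * E * e) * P.eps ^ 2 * r + γ * r ^ 2 * (2 * Mx * E * e / W₀) + γ * r * (S₀ * E) +
      (S₀ * E) / r + B1RG242Torus.α P a k * P.eps ^ 2 * (r + n) * (S₀ * E)) := by
    have h := hmain
    rw [hFlocdef, hMlocdef, hSdef] at h
    exact h
  have hM_le := absorb_step hE0 hW₀pos hM0 hr0 hκ hmain'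
  -- the budget of the absorbed terms
  have hWr : W₀ / r ≤ 8 / (cb * n) := by
    have h1 : W₀ / r ≤ 4 / rm := by
      rw [div_le_div_iff₀ hr0 hrm0]
      have h2 : W₀ * (rm : ℝ) = min (rm : ℝ) (max 0 ρ₀) := by rw [hW₀_app]; field_simp
      rw [h2, max_eq_right hρ₀0]
      linarith only [hrlow]
    have h4 : 4 / (rm : ℝ) ≤ 8 / (cb * n) := by
      rw [div_le_div_iff₀ hrm0 (by positivity)]; linarith only [hrm2]
    exact h1.trans h4
  have hbudget := budget_step hW₀1 hF0 he0.le hr0 hγ0 hc0 hn hc_v.le hα.le ha.le hrc hrn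
    hγn hWr hαa hsp
  have h7 : 0 ≤ 32 * e * c_v / cb * (n * P.eps ^ 2 * F) := by positivity
  have h8 : C_L * W₀ * (F * e * P.eps ^ 2 * r + (γ * r + 1 / r + B1RG242Torus.α P a k * P.eps ^ 2 * (r + n)) * S₀) ≤
      C_L * (K₁ * (n * P.eps ^ 2 * F)) := by
    rw [mul_assoc C_L]
    refine mul_le_mul_of_nonneg_left ?_ hCL.le
    rw [hS₀def, hK₁]
    exact hbudget
  linarith only [hM_le, h8, h7]

end Main

/-! ## §5 The same members under the PRINTED hypothesis (7.3.1) alone — small plaquette variables, no gauge condition — for cubes in a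
non-wrapping ball (p. 326: *"by change of gauge u_k can be transformed in a local region Λ into a configuration … smooth and small"*) -/

section SmallPlaquette

variable {d : ℕ}

open BIJ85CentredAxialGauge (centredGauge dist1_centredGauge_le)
open BIJ85HolonomyDeviation (norm_holCK_sub_one_le)
open BIJ88NeumannPropagatorSmallPlaquetteRegion (holCK_congr supDist_corner_le_of_mem_cubeT)
open BIJ88NeumannPropagatorFlatDecayCube (cubePt)

/-- kernel: **the plaquette variables are gauge invariant** (`U(1)`): `|u^h(∂p) − 1| = |u(∂p) − 1|`.
[cite: BalabanImbrieJaffe1985, (2.7) p.303] -/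
theorem norm_toC_plaqHol_gaugeAct_sub_one (h : GaugeTransf P 0 U1) (U : GaugeField P 0 U1) (p : Balaban1983to89.Plaq P 0) :
    ‖toC (GaugeField.plaqHol (GaugeField.gaugeAct h U) p) - 1‖ = ‖toC (GaugeField.plaqHol U p) - 1‖ := by
  rw [← BIJ88Smooth43Axial.dist1_eq_norm_toC_sub_one, ← BIJ88Smooth43Axial.dist1_eq_norm_toC_sub_one, T4ReTrLipUnitary.plaqHol_gaugeAct,
    GaugeGroup.dist1_conj]

/-- kernel: **the change of gauge of p. 326 for a fitting cube** — if `|u(∂p) − 1| ≤ θ` for all plaquettes, the cube `□ = c·L^k + Π[0, L^kM_i)`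
lies in the ball of sup-radius `R ≥ L^kM_i` around its corner and the ball does not wrap (`2R + 4 < |T|`), then in p30's centred axial gauge
`h` of that ball the field `u^h` is bondwise `T`-small on the bonds of `□*` for any `T ≥ (d−1)Rθ` and its block holonomies on `□` are within
`d(L^k − 1)T` of `1` (p33's `norm_holCK_sub_one_le` for the field cut to the ball, gen 16's locality `holCK_congr`).
[cite: BalabanImbrieJaffe1985, (7.3.1) p.326] -/
theorem smallField_gaugeAct_cubeT (hPd : P.d = d + 1) {k : ℕ} (hk : k ≤ P.m + P.K) (U : GaugeField P 0 U1) {θ : ℝ} (hθ : 0 ≤ θ)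
    (hplaq : ∀ p : Balaban1983to89.Plaq P 0, ‖toC (GaugeField.plaqHol U p) - 1‖ ≤ θ) {c M : Fin (d + 1) → ℕ} {R : ℕ}
    (hfit : ∀ i, c i * P.L ^ k + P.L ^ k * M i ≤ P.sitesPerDir 0) (hRM : ∀ i, P.L ^ k * M i ≤ R) (hR : 2 * R + 4 < P.sitesPerDir 0)
    {T : ℝ} (hT : ((P.d - 1 : ℕ) : ℝ) * R * θ ≤ T) :
    (∀ b ∈ starB (cubeT hPd (P.L ^ k) c fun i => P.L ^ k * M i),
        ‖toC (GaugeField.gaugeAct (centredGauge U (cubePt hPd (P.L ^ k) c 0) R) U b) - 1‖ ≤ T) ∧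
      (∀ y ∈ cubeT hPd (P.L ^ k) c (fun i => P.L ^ k * M i),
        ‖holCK (GaugeField.gaugeAct (centredGauge U (cubePt hPd (P.L ^ k) c 0) R) U) k y - 1‖ ≤ P.d * ((P.L : ℝ) ^ k - 1) * T) := by
  set x₀ := cubePt hPd (P.L ^ k) c 0 with hx₀
  set h : GaugeTransf P 0 U1 := centredGauge U x₀ R with hh
  have hT0 : 0 ≤ T := le_trans (by positivity) hT
  have hplaq' : ∀ p : Balaban1983to89.Plaq P 0, dist1 (GaugeField.plaqHol U p) ≤ θ := fun p => by
    rw [BIJ88Smooth43Axial.dist1_eq_norm_toC_sub_one]; exact hplaq p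
  have hΩ : IsBlockUnion k (cubeT hPd (P.L ^ k) c fun i => P.L ^ k * M i) := isBlockUnion_cubeT hPd hk rfl hfit
  -- in the ball the gauge copy is bondwise small
  have hball : ∀ b : PBond P 0, supDist x₀ b.src ≤ R → ‖toC (GaugeField.gaugeAct h U b) - 1‖ ≤ T := fun b hb => by
    have h2 := dist1_centredGauge_le U hθ hplaq' x₀ hR b.src hb b.dir
    rw [BIJ88Smooth43Axial.dist1_eq_norm_toC_sub_one, ← hh] at h2
    refine le_trans h2 (le_trans ?_ hT)
    have : (supDist x₀ b.src : ℝ) ≤ R := by exact_mod_cast hb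
    exact mul_le_mul_of_nonneg_right (mul_le_mul_of_nonneg_left this (Nat.cast_nonneg _)) hθ
  have hinQ : ∀ z ∈ cubeT hPd (P.L ^ k) c (fun i => P.L ^ k * M i), supDist x₀ z ≤ R := fun z hz =>
    supDist_corner_le_of_mem_cubeT hPd hfit hRM hz
  refine ⟨fun b hb => hball b (hinQ b.src ((mem_starB _ b).1 hb).1), fun y hy => ?_⟩
  -- the field cut to the ball: bondwise `T`-small everywhere, equal to `u^h` on the block of `y`
  set U' : GaugeField P 0 U1 := fun b => if supDist x₀ b.src ≤ R then GaugeField.gaugeAct h U b else 1 with hU'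
  have hbond : ∀ b : PBond P 0, ‖toC (U' b) - 1‖ ≤ T := fun b => by
    by_cases hb : supDist x₀ b.src ≤ R
    · have h1 : U' b = GaugeField.gaugeAct h U b := by simp only [hU', hb, if_true]
      rw [h1]; exact hball b hb
    · have h1 : U' b = 1 := by simp only [hU', hb, if_false]
      rw [h1, toC_one, sub_self, norm_zero]; exact hT0
  have htree : ‖holCK U' k y - 1‖ ≤ P.d * ((P.L : ℝ) ^ k - 1) * T := norm_holCK_sub_one_le hT0 hbond k y
  have hagree : holCK (GaugeField.gaugeAct h U) k y = holCK U' k y := by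
    refine holCK_congr k (by omega) y fun b hbs _ => ?_
    have hby : b.src ∈ cubeT hPd (P.L ^ k) c (fun i => P.L ^ k * M i) := hΩ y hy (mem_blockK.2 hbs)
    have hbR : supDist x₀ b.src ≤ R := hinQ b.src hby
    simp only [hU', hbR, if_true]
  rw [hagree]; exact htree

/-- kernel: **the modulus of the covariant derivative of `G_k(Ω,u)f` is gauge invariant**: with `G_k(Ω,u^h)(hf) = h·G_k(Ω,u)f` and
`u^h_b = h(b₋)u_b\overline{h(b₊)}`, `|(D_{u^h}G_k(Ω,u^h)(hf))(b)| = |(D_uG_k(Ω,u)f)(b)|`. [cite: BalabanImbrieJaffe1985, (2.7) p.303] -/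
theorem norm_covD_gBox_gaugeAct_mulVec {k : ℕ} (hk : 0 + k ≤ P.m + P.K) {a c : ℝ} (hc : c ≠ 0) (ha : 0 < a) (h : GaugeTransf P 0 U1)
    (U : GaugeField P 0 U1) {Ω : Finset (Balaban1983to89.Site P 0)} (hΩ : IsBlockUnion k Ω) (f : Balaban1983to89.Site P 0 → ℂ)
    (z : Balaban1983to89.Site P 0) (ν : Fin P.d) :
    ‖covD c (cfg (GaugeField.gaugeAct h U)) (gBox a c (GaugeField.gaugeAct h U) k Ω *ᵥ fun w => toC (h w) * f w) ⟨z, ν⟩‖ =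
      ‖covD c (cfg U) (gBox a c U k Ω *ᵥ f) ⟨z, ν⟩‖ := by
  rw [gBox_gaugeAct_mulVec hk hc ha h U hΩ f]
  show ‖(c : ℂ) * (cfg (GaugeField.gaugeAct h U) ⟨z, ν⟩ * (toC (h (z.shift ν)) * (gBox a c U k Ω *ᵥ f) (z.shift ν)) -
      toC (h z) * (gBox a c U k Ω *ᵥ f) z)‖ = ‖(c : ℂ) * (cfg U ⟨z, ν⟩ * (gBox a c U k Ω *ᵥ f) (z.shift ν) - (gBox a c U k Ω *ᵥ f) z)‖
  rw [norm_mul, norm_mul, norm_covDiff_gaugeAct h U _ z ν]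

/-- **THE COVARIANT-DERIVATIVE MEMBER OF [6] (1.10) FOR THE CUBE PROPAGATORS UNDER THE PRINTED HYPOTHESIS (7.3.1) ONLY, AT THE BONDS OF
DEPTH `≥ L^k`** — §4's `decay110_smallField_cube_deriv` with its bondwise hypotheses DISCHARGED by the change of gauge of p. 326 (the modulus
of `(D_uG_k(□,u)f)(b)` is gauge invariant, `norm_covD_gBox_gaugeAct_mulVec`): for `d + 1 ∈ {2, 3}`, `L` odd `> 1`, `a > 0` there are `t₀, c₁ > 0`
(from `(d, L, a)` only) such that for every volume, every `1 ≤ k ≤ K`, every `U(1)` field with `|u(∂p) − 1| ≤ θ` for all plaquettes and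
`2d³(L^{2k}θ)² ≤ 1`, every fitting cube inside the non-wrapping ball of sup-radius `R ≥ L^kM_i` around its corner, every `T ≥ (d−1)Rθ` with
`2(L^k−1)L^k·d·T² + 2(d(L^k−1)T)² ≤ 1/2`, every bond `⟨x, x+e_μ⟩` with `dist_∞(x, T∖□) ≥ L^k`, every `f` with `|f| ≤ F` vanishing at
sup-distance `< D` from `x`: `|(D_uG_k(□,u)f)(⟨x, x+e_μ⟩)| ≤ c₁(L^kε)e^{−t₀D/L^k}F` — NO gauge condition.
[cite: BalabanImbrieJaffe1985, (7.3.1) p.326; Balaban1983RegularityDecay, (1.10) p.573] -/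
theorem decay110_smallPlaquette_cube_deriv (d L : ℕ) (hd1 : 1 ≤ d) (hd3 : d + 1 ≤ 3) (hL : Odd L ∧ 1 < L) {a : ℝ} (ha : 0 < a) :
    ∃ t₀ c₁ : ℝ, 0 < t₀ ∧ 0 < c₁ ∧ ∀ (P : Params) (hPd : P.d = d + 1), P.L = L →
      ∀ k : ℕ, 1 ≤ k → k ≤ P.K → ∀ (U : GaugeField P 0 U1) (θ : ℝ), 0 ≤ θ →
        (∀ p : Balaban1983to89.Plaq P 0, ‖toC (GaugeField.plaqHol U p) - 1‖ ≤ θ) →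
        2 * (P.d : ℝ) ^ 3 * (((P.L : ℝ) ^ k) ^ 2 * θ) ^ 2 ≤ 1 →
        ∀ (c M : Fin (d + 1) → ℕ) (R : ℕ), (∀ i, 1 ≤ M i) → (∀ i, c i * P.L ^ k + P.L ^ k * M i ≤ P.sitesPerDir 0) →
          (∀ i, P.L ^ k * M i ≤ R) → 2 * R + 4 < P.sitesPerDir 0 →
        ∀ (T : ℝ), ((P.d - 1 : ℕ) : ℝ) * R * θ ≤ T →
          2 * (((P.L : ℝ) ^ k - 1) * (P.L : ℝ) ^ k) * P.d * T ^ 2 + 2 * (P.d * ((P.L : ℝ) ^ k - 1) * T) ^ 2 ≤ 1 / 2 →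
          ∀ (x : Balaban1983to89.Site P 0) (μ : Fin P.d) (f : Balaban1983to89.Site P 0 → ℂ) (F D : ℝ),
            (∀ z, ‖f z‖ ≤ F) → (∀ z, f z ≠ 0 → D ≤ (supDist x z : ℝ)) →
            (∀ w, w ∉ cubeT hPd (P.L ^ k) c (fun i => P.L ^ k * M i) → P.L ^ k ≤ supDist x w) →
            ‖covD P.eps⁻¹ (cfg U) (gBox (B1RG242Torus.α P a k * (P.L : ℝ) ^ (k * P.d)) P.eps⁻¹ U k
                (cubeT hPd (P.L ^ k) c fun i => P.L ^ k * M i) *ᵥ f) ⟨x, μ⟩‖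
              ≤ c₁ * P.spacing k * Real.exp (-(t₀ * D / (P.L : ℝ) ^ k)) * F := by
  obtain ⟨t₀, c₁, ht₀, hc₁, H⟩ := decay110_smallField_cube_deriv d L hd1 hd3 hL ha
  refine ⟨t₀, c₁, ht₀, hc₁, ?_⟩
  intro P hPd hPL k hk1 hkK U θ hθ hplaq hsmall c M R hM hfit hRM hR T hT hsmallT x μ f F D hF hsupp hdeep
  have hN : ∀ i, P.L ^ k * M i < P.sitesPerDir 0 := fun i => by have := hRM i; omega
  have hk : k ≤ P.m + P.K := hkK.trans (Nat.le_add_left _ _)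
  have hk0 : 0 + k ≤ P.m + P.K := by omega
  have hL1 : (1 : ℝ) < P.L := B1RG242Torus.one_lt_cast_L P
  have ha' : 0 < B1RG242Torus.α P a k * (P.L : ℝ) ^ (k * P.d) :=
    mul_pos (mul_pos (B1.aSeq_pos ha hL1 hk1) (inv_pos.2 (pow_pos (P.spacing_pos k) 2))) (pow_pos P.cast_L_pos _)
  have hc' : P.eps⁻¹ ≠ 0 := inv_ne_zero P.eps_pos.ne'
  have hΩ : IsBlockUnion k (cubeT hPd (P.L ^ k) c fun i => P.L ^ k * M i) := isBlockUnion_cubeT hPd hk rfl hfit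
  obtain ⟨hInt, hTree⟩ := smallField_gaugeAct_cubeT hPd hk U hθ hplaq hfit hRM hR hT
  set h := centredGauge U (cubePt hPd (P.L ^ k) c 0) R with hh
  rw [← norm_covD_gBox_gaugeAct_mulVec hk0 hc' ha' h U hΩ f x μ]
  exact H P hPd hPL k hk1 hkK c M hM hfit hN (GaugeField.gaugeAct h U) θ T (P.d * ((P.L : ℝ) ^ k - 1) * T) hθ
    (fun p => by rw [norm_toC_plaqHol_gaugeAct_sub_one]; exact hplaq p) hsmall (fun b hb _ => hInt b hb) hTree hsmallT x μ _ F D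
    (fun z => by rw [norm_mul, norm_toC, one_mul]; exact hF z) (fun z hz => hsupp z (fun hf => hz (by rw [hf, mul_zero]))) hdeep

/-- **THE SAME BOUND IN p31's (1.10) SHAPE** (distance `B5Ineq137Torus.T = |·−·|_∞`, rate `e^{−δ₀εD}`, `L^kε ≤ 1` for `k ≤ K`): the cube
companion of p30's `decay110_smallField_deriv_T`, under (7.3.1) only. [cite: BalabanImbrieJaffe1985, (7.3.1) p.326; Balaban1983RegularityDecay, (1.10) p.573] -/
theorem decay110_smallPlaquette_cube_deriv_T (d L : ℕ) (hd1 : 1 ≤ d) (hd3 : d + 1 ≤ 3) (hL : Odd L ∧ 1 < L) {a : ℝ} (ha : 0 < a) :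
    ∃ δ₀ c₁ : ℝ, 0 < δ₀ ∧ 0 < c₁ ∧ ∀ (P : Params) (hPd : P.d = d + 1), P.L = L →
      ∀ k : ℕ, 1 ≤ k → k ≤ P.K → ∀ (U : GaugeField P 0 U1) (θ : ℝ), 0 ≤ θ →
        (∀ p : Balaban1983to89.Plaq P 0, ‖toC (GaugeField.plaqHol U p) - 1‖ ≤ θ) →
        2 * (P.d : ℝ) ^ 3 * (((P.L : ℝ) ^ k) ^ 2 * θ) ^ 2 ≤ 1 →
        ∀ (c M : Fin (d + 1) → ℕ) (R : ℕ), (∀ i, 1 ≤ M i) → (∀ i, c i * P.L ^ k + P.L ^ k * M i ≤ P.sitesPerDir 0) →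
          (∀ i, P.L ^ k * M i ≤ R) → 2 * R + 4 < P.sitesPerDir 0 →
        ∀ (T : ℝ), ((P.d - 1 : ℕ) : ℝ) * R * θ ≤ T →
          2 * (((P.L : ℝ) ^ k - 1) * (P.L : ℝ) ^ k) * P.d * T ^ 2 + 2 * (P.d * ((P.L : ℝ) ^ k - 1) * T) ^ 2 ≤ 1 / 2 →
          ∀ (x : Balaban1983to89.Site P 0) (μ : Fin P.d) (f : Balaban1983to89.Site P 0 → ℂ) (F D : ℝ),
            (∀ z, ‖f z‖ ≤ F) → 0 ≤ D → (∀ z, f z ≠ 0 → D ≤ B5Ineq137Torus.T P 0 x z) →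
            (∀ w, w ∉ cubeT hPd (P.L ^ k) c (fun i => P.L ^ k * M i) → P.L ^ k ≤ supDist x w) →
            ‖covD P.eps⁻¹ (cfg U) (gBox (B1RG242Torus.α P a k * (P.L : ℝ) ^ (k * P.d)) P.eps⁻¹ U k
                (cubeT hPd (P.L ^ k) c fun i => P.L ^ k * M i) *ᵥ f) ⟨x, μ⟩‖
              ≤ c₁ * Real.exp (-(δ₀ * (P.eps * D))) * F := by
  obtain ⟨t₀, c₁, ht₀, hc₁, H⟩ := decay110_smallPlaquette_cube_deriv d L hd1 hd3 hL ha
  refine ⟨t₀, c₁, ht₀, hc₁, ?_⟩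
  intro P hPd hPL k hk1 hkK U θ hθ hplaq hsmall c M R hM hfit hRM hR T hT hsmallT x μ f F D hF hD hsupp hdeep
  have h := H P hPd hPL k hk1 hkK U θ hθ hplaq hsmall c M R hM hfit hRM hR T hT hsmallT x μ f F D hF
    (fun z hz => by rw [← B3Bound323ZeroTorus.T_eq_supDist]; exact hsupp z hz) hdeep
  have hF0 : 0 ≤ F := (norm_nonneg _).trans (hF x)
  have hsp1 : (P.L : ℝ) ^ k * P.eps ≤ 1 := B3GkZeroTorusRescaled.spacing_le_one P hkK
  have hn : 0 < (P.L : ℝ) ^ k := pow_pos P.cast_L_pos k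
  have hexp : Real.exp (-(t₀ * D / (P.L : ℝ) ^ k)) ≤ Real.exp (-(t₀ * (P.eps * D))) := by
    rw [Real.exp_le_exp, neg_le_neg_iff, le_div_iff₀ hn]
    nlinarith [mul_nonneg ht₀.le hD, P.eps_pos.le]
  calc _ ≤ c₁ * P.spacing k * Real.exp (-(t₀ * D / (P.L : ℝ) ^ k)) * F := h
    _ ≤ c₁ * 1 * Real.exp (-(t₀ * (P.eps * D))) * F :=
        mul_le_mul_of_nonneg_right
          (mul_le_mul (mul_le_mul_of_nonneg_left hsp1 hc₁.le) hexp (Real.exp_pos _).le (by positivity)) hF0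
    _ = c₁ * Real.exp (-(t₀ * (P.eps * D))) * F := by rw [mul_one]

end SmallPlaquette

/-! ## §6 (v1.1) The members in the (H1.10″)-type INPUT shape of the hypothesis-form chain (r01's `input110_deriv_regular_deep` binder:
distance `B5Ineq137Torus.T`, level-`k` units `e^{−t₀(L^k)^{−1}D}`, one power of the spacing `L^kε`, deep rows as a ball condition), and the
bound at every gauge copy `u^h` -/

section InputShape

variable {d : ℕ}

/-- **§4 IN THE INPUT SHAPE**: for the cube propagator at a field with p27's bondwise `(T, δ)` hypotheses on `□` and plaquettes within `θ` of `1`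
(`2d³(L^{2k}θ)² ≤ 1`), every row `x` whose open `L^k`-ball lies in `□` (`|x − y|_∞ < L^k → y ∈ □`), every `f` with `|f| ≤ F` vanishing at
sup-distance `< D` from `x`, every direction `μ`:  `‖(D_uG_k(□,u)f)(⟨x, x+e_μ⟩)‖ ≤ (L^kε)·(c₁e^{−t₀(L^k)^{−1}D}F)` — the covariant-derivative twin
of p27's `decay110_smallField_cube_input`. [cite: BalabanImbrieJaffe1985, (7.3.1) p.326; Balaban1983RegularityDecay, (1.10) p.573] -/
theorem decay110_smallField_cube_deriv_input (d L : ℕ) (hd1 : 1 ≤ d) (hd3 : d + 1 ≤ 3) (hL : Odd L ∧ 1 < L) {a : ℝ} (ha : 0 < a) :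
    ∃ t₀ c₁ : ℝ, 0 < t₀ ∧ 0 < c₁ ∧ ∀ (P : Params) (hPd : P.d = d + 1), P.L = L →
      ∀ k : ℕ, 1 ≤ k → k ≤ P.K → ∀ (c M : Fin (d + 1) → ℕ), (∀ i, 1 ≤ M i) →
        (∀ i, c i * P.L ^ k + P.L ^ k * M i ≤ P.sitesPerDir 0) → (∀ i, P.L ^ k * M i < P.sitesPerDir 0) →
        ∀ (U : GaugeField P 0 U1) (θ T δ : ℝ), 0 ≤ θ →
          (∀ p : Balaban1983to89.Plaq P 0, ‖toC (GaugeField.plaqHol U p) - 1‖ ≤ θ) →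
          2 * (P.d : ℝ) ^ 3 * (((P.L : ℝ) ^ k) ^ 2 * θ) ^ 2 ≤ 1 →
          (∀ b ∈ starB (cubeT hPd (P.L ^ k) c fun i => P.L ^ k * M i), blkIter k b.src = blkIter k b.tgt → ‖toC (U b) - 1‖ ≤ T) →
          (∀ y ∈ cubeT hPd (P.L ^ k) c (fun i => P.L ^ k * M i), ‖holCK U k y - 1‖ ≤ δ) →
          2 * (((P.L : ℝ) ^ k - 1) * (P.L : ℝ) ^ k) * P.d * T ^ 2 + 2 * δ ^ 2 ≤ 1 / 2 →
          ∀ (x : Balaban1983to89.Site P 0),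
            (∀ y, B5Ineq137Torus.T P 0 x y < (P.L : ℝ) ^ k → y ∈ cubeT hPd (P.L ^ k) c (fun i => P.L ^ k * M i)) →
          ∀ (f : Balaban1983to89.Site P 0 → ℂ) (F D : ℝ), (∀ y, ‖f y‖ ≤ F) → (∀ y, f y ≠ 0 → D ≤ B5Ineq137Torus.T P 0 x y) →
          ∀ (μ : Fin P.d),
            ‖covD P.eps⁻¹ (cfg U) (gBox (B1RG242Torus.α P a k * (P.L : ℝ) ^ (k * P.d)) P.eps⁻¹ U k
                (cubeT hPd (P.L ^ k) c fun i => P.L ^ k * M i) *ᵥ f) ⟨x, μ⟩‖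
              ≤ P.spacing k * (c₁ * Real.exp (-(t₀ * (((P.L : ℝ) ^ k)⁻¹ * D))) * F) := by
  obtain ⟨t₀, c₁, ht₀, hc₁, H⟩ := decay110_smallField_cube_deriv d L hd1 hd3 hL ha
  refine ⟨t₀, c₁, ht₀, hc₁, ?_⟩
  intro P hPd hPL k hk1 hkK c M hM hfit hN U θ T δ hθ hplaq hsmall hInt hTree hsmallT x hdeep f F D hF hsupp μ
  have h := H P hPd hPL k hk1 hkK c M hM hfit hN U θ T δ hθ hplaq hsmall hInt hTree hsmallT x μ f F D hF
    (fun z hz => by rw [← B3Bound323ZeroTorus.T_eq_supDist]; exact hsupp z hz)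
    (fun w hw => by
      by_contra hlt
      exact hw (hdeep w (by rw [B3Bound323ZeroTorus.T_eq_supDist]; exact_mod_cast (not_le.1 hlt))))
  calc _ ≤ c₁ * P.spacing k * Real.exp (-(t₀ * D / (P.L : ℝ) ^ k)) * F := h
    _ = P.spacing k * (c₁ * Real.exp (-(t₀ * (((P.L : ℝ) ^ k)⁻¹ * D))) * F) := by
        rw [show t₀ * D / (P.L : ℝ) ^ k = t₀ * (((P.L : ℝ) ^ k)⁻¹ * D) by ring]; ring

/-- **§5 IN THE INPUT SHAPE**: the same under the PRINTED plaquette smallness (7.3.1) only (cube inside the non-wrapping ball of sup-radius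
`R ≥ L^kM_i` around its corner, `T ≥ dRθ` with the displayed threshold), no gauge condition:
`‖(D_uG_k(□,u)f)(⟨x, x+e_μ⟩)‖ ≤ (L^kε)·(c₁e^{−t₀(L^k)^{−1}D}F)` at the rows whose open `L^k`-ball lies in `□`.
[cite: BalabanImbrieJaffe1985, (7.3.1) p.326; Balaban1983RegularityDecay, (1.10) p.573] -/
theorem decay110_smallPlaquette_cube_deriv_input (d L : ℕ) (hd1 : 1 ≤ d) (hd3 : d + 1 ≤ 3) (hL : Odd L ∧ 1 < L) {a : ℝ} (ha : 0 < a) :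
    ∃ t₀ c₁ : ℝ, 0 < t₀ ∧ 0 < c₁ ∧ ∀ (P : Params) (hPd : P.d = d + 1), P.L = L →
      ∀ k : ℕ, 1 ≤ k → k ≤ P.K → ∀ (U : GaugeField P 0 U1) (θ : ℝ), 0 ≤ θ →
        (∀ p : Balaban1983to89.Plaq P 0, ‖toC (GaugeField.plaqHol U p) - 1‖ ≤ θ) →
        2 * (P.d : ℝ) ^ 3 * (((P.L : ℝ) ^ k) ^ 2 * θ) ^ 2 ≤ 1 →
        ∀ (c M : Fin (d + 1) → ℕ) (R : ℕ), (∀ i, 1 ≤ M i) → (∀ i, c i * P.L ^ k + P.L ^ k * M i ≤ P.sitesPerDir 0) →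
          (∀ i, P.L ^ k * M i ≤ R) → 2 * R + 4 < P.sitesPerDir 0 →
        ∀ (T : ℝ), ((P.d - 1 : ℕ) : ℝ) * R * θ ≤ T →
          2 * (((P.L : ℝ) ^ k - 1) * (P.L : ℝ) ^ k) * P.d * T ^ 2 + 2 * (P.d * ((P.L : ℝ) ^ k - 1) * T) ^ 2 ≤ 1 / 2 →
          ∀ (x : Balaban1983to89.Site P 0),
            (∀ y, B5Ineq137Torus.T P 0 x y < (P.L : ℝ) ^ k → y ∈ cubeT hPd (P.L ^ k) c (fun i => P.L ^ k * M i)) →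
          ∀ (f : Balaban1983to89.Site P 0 → ℂ) (F D : ℝ), (∀ y, ‖f y‖ ≤ F) → (∀ y, f y ≠ 0 → D ≤ B5Ineq137Torus.T P 0 x y) →
          ∀ (μ : Fin P.d),
            ‖covD P.eps⁻¹ (cfg U) (gBox (B1RG242Torus.α P a k * (P.L : ℝ) ^ (k * P.d)) P.eps⁻¹ U k
                (cubeT hPd (P.L ^ k) c fun i => P.L ^ k * M i) *ᵥ f) ⟨x, μ⟩‖
              ≤ P.spacing k * (c₁ * Real.exp (-(t₀ * (((P.L : ℝ) ^ k)⁻¹ * D))) * F) := by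
  obtain ⟨t₀, c₁, ht₀, hc₁, H⟩ := decay110_smallPlaquette_cube_deriv d L hd1 hd3 hL ha
  refine ⟨t₀, c₁, ht₀, hc₁, ?_⟩
  intro P hPd hPL k hk1 hkK U θ hθ hplaq hsmall c M R hM hfit hRM hR T hT hsmallT x hdeep f F D hF hsupp μ
  have h := H P hPd hPL k hk1 hkK U θ hθ hplaq hsmall c M R hM hfit hRM hR T hT hsmallT x μ f F D hF
    (fun z hz => by rw [← B3Bound323ZeroTorus.T_eq_supDist]; exact hsupp z hz)
    (fun w hw => by
      by_contra hlt
      exact hw (hdeep w (by rw [B3Bound323ZeroTorus.T_eq_supDist]; exact_mod_cast (not_le.1 hlt))))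
  calc _ ≤ c₁ * P.spacing k * Real.exp (-(t₀ * D / (P.L : ℝ) ^ k)) * F := h
    _ = P.spacing k * (c₁ * Real.exp (-(t₀ * (((P.L : ℝ) ^ k)⁻¹ * D))) * F) := by
        rw [show t₀ * D / (P.L : ℝ) ^ k = t₀ * (((P.L : ℝ) ^ k)⁻¹ * D) by ring]; ring

/-- **§4 AT EVERY GAUGE COPY**: if `u` satisfies the hypotheses of `decay110_smallField_cube_deriv` (bondwise `(T, δ)` on `□`, plaquettes within
`θ` of `1`), the bound holds verbatim for `G_k(□,u^h)` and `D_{u^h}`, every gauge transformation `h` (the plaquettes and the modulus of the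
covariant derivative are gauge invariant; the source is rotated by `h`) — the covariant-derivative twin of p27's
`decay110_smallField_cube_gaugeAct`. [cite: BalabanImbrieJaffe1985, (2.7) p.303; Balaban1983RegularityDecay, (1.10) p.573] -/
theorem decay110_smallField_cube_deriv_gaugeAct (d L : ℕ) (hd1 : 1 ≤ d) (hd3 : d + 1 ≤ 3) (hL : Odd L ∧ 1 < L) {a : ℝ} (ha : 0 < a) :
    ∃ t₀ c₁ : ℝ, 0 < t₀ ∧ 0 < c₁ ∧ ∀ (P : Params) (hPd : P.d = d + 1), P.L = L →
      ∀ k : ℕ, 1 ≤ k → k ≤ P.K → ∀ (c M : Fin (d + 1) → ℕ), (∀ i, 1 ≤ M i) →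
        (∀ i, c i * P.L ^ k + P.L ^ k * M i ≤ P.sitesPerDir 0) → (∀ i, P.L ^ k * M i < P.sitesPerDir 0) →
        ∀ (U : GaugeField P 0 U1) (θ T δ : ℝ), 0 ≤ θ →
          (∀ p : Balaban1983to89.Plaq P 0, ‖toC (GaugeField.plaqHol U p) - 1‖ ≤ θ) →
          2 * (P.d : ℝ) ^ 3 * (((P.L : ℝ) ^ k) ^ 2 * θ) ^ 2 ≤ 1 →
          (∀ b ∈ starB (cubeT hPd (P.L ^ k) c fun i => P.L ^ k * M i), blkIter k b.src = blkIter k b.tgt → ‖toC (U b) - 1‖ ≤ T) →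
          (∀ y ∈ cubeT hPd (P.L ^ k) c (fun i => P.L ^ k * M i), ‖holCK U k y - 1‖ ≤ δ) →
          2 * (((P.L : ℝ) ^ k - 1) * (P.L : ℝ) ^ k) * P.d * T ^ 2 + 2 * δ ^ 2 ≤ 1 / 2 →
          ∀ (h : GaugeTransf P 0 U1) (x : Balaban1983to89.Site P 0) (μ : Fin P.d) (f : Balaban1983to89.Site P 0 → ℂ) (F D : ℝ),
            (∀ z, ‖f z‖ ≤ F) → (∀ z, f z ≠ 0 → D ≤ (supDist x z : ℝ)) →
            (∀ w, w ∉ cubeT hPd (P.L ^ k) c (fun i => P.L ^ k * M i) → P.L ^ k ≤ supDist x w) →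
            ‖covD P.eps⁻¹ (cfg (GaugeField.gaugeAct h U)) (gBox (B1RG242Torus.α P a k * (P.L : ℝ) ^ (k * P.d)) P.eps⁻¹
                (GaugeField.gaugeAct h U) k (cubeT hPd (P.L ^ k) c fun i => P.L ^ k * M i) *ᵥ f) ⟨x, μ⟩‖
              ≤ c₁ * P.spacing k * Real.exp (-(t₀ * D / (P.L : ℝ) ^ k)) * F := by
  obtain ⟨t₀, c₁, ht₀, hc₁, H⟩ := decay110_smallField_cube_deriv d L hd1 hd3 hL ha
  refine ⟨t₀, c₁, ht₀, hc₁, ?_⟩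
  intro P hPd hPL k hk1 hkK c M hM hfit hN U θ T δ hθ hplaq hsmall hInt hTree hsmallT h x μ f F D hF hsupp hdeep
  have hk : k ≤ P.m + P.K := hkK.trans (Nat.le_add_left _ _)
  have hk0 : 0 + k ≤ P.m + P.K := by omega
  have hL1 : (1 : ℝ) < P.L := B1RG242Torus.one_lt_cast_L P
  have ha' : 0 < B1RG242Torus.α P a k * (P.L : ℝ) ^ (k * P.d) :=
    mul_pos (mul_pos (B1.aSeq_pos ha hL1 hk1) (inv_pos.2 (pow_pos (P.spacing_pos k) 2))) (pow_pos P.cast_L_pos _)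
  have hc' : P.eps⁻¹ ≠ 0 := inv_ne_zero P.eps_pos.ne'
  have hΩ : IsBlockUnion k (cubeT hPd (P.L ^ k) c fun i => P.L ^ k * M i) := isBlockUnion_cubeT hPd hk rfl hfit
  -- rotate the source back: `f = h·g` with `g = h̄f`
  set g : Balaban1983to89.Site P 0 → ℂ := fun z => (starRingEnd ℂ) (toC (h z)) * f z with hgdef
  have hgz : ∀ z, g z = (starRingEnd ℂ) (toC (h z)) * f z := fun z => rfl
  have hfg : f = fun z => toC (h z) * g z := by
    funext z
    rw [hgz, ← mul_assoc, BIJ88NeumannPropagator227Torus.toC_mul_conj, one_mul]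
  have hng : ∀ z, ‖g z‖ = ‖f z‖ := fun z => by
    rw [hgz, norm_mul, RCLike.norm_conj, norm_toC, one_mul]
  rw [hfg, norm_covD_gBox_gaugeAct_mulVec hk0 hc' ha' h U hΩ g x μ]
  exact H P hPd hPL k hk1 hkK c M hM hfit hN U θ T δ hθ hplaq hsmall hInt hTree hsmallT x μ g F D (fun z => by rw [hng]; exact hF z)
    (fun z hz => hsupp z (fun hf => hz (by rw [hgz, hf, mul_zero]))) hdeep

end InputShape

/-! ## §7 (v1.2) The members under (7.3.1) with a threshold UNIFORM in the cube and the volume: the blockwise centred gauge (p27 gen 34's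
device for the value member `decay110_smallPlaquette_cube_uniform`; the gauge lemma is gen 16's `BIJ88NeumannPropagatorSmallPlaquetteRegion`
v1.2 `smallField_blockGauge`) — the hypotheses of §4 are block-local, so the change of gauge of p. 326 is made `k`-block by `k`-block and the
ball radius `R` of §5 disappears -/

section Uniform

variable {d : ℕ}

open BIJ85CentredAxialGauge (centredGauge)
open BIJ88NeumannPropagatorSmallPlaquetteRegion (smallField_blockGauge)

/-- **THE COVARIANT-DERIVATIVE MEMBER OF [6] (1.10) FOR THE CUBE PROPAGATORS UNDER THE PRINTED HYPOTHESIS (7.3.1) ONLY, WITH A THRESHOLD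
DEPENDING ON `(d, L^k)` ONLY** — uniform in the cube (its size `M` and position `c`), in the volume and in the field: for `d + 1 ∈ {2, 3}`,
`L` odd `> 1`, `a > 0` there are `t₀, c₁ > 0` (from `(d, L, a)` only) such that for every volume with more than two `k`-blocks per direction
(`2(L^k − 1) + 4 < |T|`), every `1 ≤ k ≤ K`, every `U(1)` field with `|u(∂p) − 1| ≤ θ` for all plaquettes and `2(d+1)³(L^{2k}θ)² ≤ 1`, every
`T ≥ d(L^k − 1)θ` (`d = P.d − 1`) with `2(L^k−1)L^k(d+1)T² + 2((d+1)(L^k−1)T)² ≤ 1/2`, every fitting no-wrap cube `□ = c·L^k + Π_i[0, L^kM_i)`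
(`M_i ≥ 1`), every bond `⟨x, x+e_μ⟩` with `dist_∞(x, T∖□) ≥ L^k`, every `f` with `|f| ≤ F` vanishing at sup-distance `< D` from `x`:
`|(D_uG_k(□,u)f)(⟨x, x+e_μ⟩)| ≤ c₁(L^kε)e^{−t₀D/L^k}F` — NO gauge condition, NO ball radius.  PROOF: §4 for `u^h` in the blockwise centred gauge
(`smallField_blockGauge`), the plaquettes and the modulus of the covariant derivative being gauge invariant (`norm_toC_plaqHol_gaugeAct_sub_one`,
`norm_covD_gBox_gaugeAct_mulVec`); the derivative twin of p27's `decay110_smallPlaquette_cube_uniform`.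
[cite: BalabanImbrieJaffe1985, (7.3.1)–(7.3.2) p.326; Balaban1983RegularityDecay, (1.10) p.573] -/
theorem decay110_smallPlaquette_cube_deriv_uniform (d L : ℕ) (hd1 : 1 ≤ d) (hd3 : d + 1 ≤ 3) (hL : Odd L ∧ 1 < L) {a : ℝ} (ha : 0 < a) :
    ∃ t₀ c₁ : ℝ, 0 < t₀ ∧ 0 < c₁ ∧ ∀ (P : Params) (hPd : P.d = d + 1), P.L = L →
      ∀ k : ℕ, 1 ≤ k → k ≤ P.K → 2 * (P.L ^ k - 1) + 4 < P.sitesPerDir 0 →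
      ∀ (U : GaugeField P 0 U1) (θ : ℝ), 0 ≤ θ →
        (∀ p : Balaban1983to89.Plaq P 0, ‖toC (GaugeField.plaqHol U p) - 1‖ ≤ θ) →
        2 * (P.d : ℝ) ^ 3 * (((P.L : ℝ) ^ k) ^ 2 * θ) ^ 2 ≤ 1 →
        ∀ (T : ℝ), ((P.d - 1 : ℕ) : ℝ) * ((P.L : ℝ) ^ k - 1) * θ ≤ T →
          2 * (((P.L : ℝ) ^ k - 1) * (P.L : ℝ) ^ k) * P.d * T ^ 2 + 2 * (P.d * ((P.L : ℝ) ^ k - 1) * T) ^ 2 ≤ 1 / 2 →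
        ∀ (c M : Fin (d + 1) → ℕ), (∀ i, 1 ≤ M i) → (∀ i, c i * P.L ^ k + P.L ^ k * M i ≤ P.sitesPerDir 0) →
          (∀ i, P.L ^ k * M i < P.sitesPerDir 0) →
          ∀ (x : Balaban1983to89.Site P 0) (μ : Fin P.d) (f : Balaban1983to89.Site P 0 → ℂ) (F D : ℝ),
            (∀ z, ‖f z‖ ≤ F) → (∀ z, f z ≠ 0 → D ≤ (supDist x z : ℝ)) →
            (∀ w, w ∉ cubeT hPd (P.L ^ k) c (fun i => P.L ^ k * M i) → P.L ^ k ≤ supDist x w) →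
            ‖covD P.eps⁻¹ (cfg U) (gBox (B1RG242Torus.α P a k * (P.L : ℝ) ^ (k * P.d)) P.eps⁻¹ U k
                (cubeT hPd (P.L ^ k) c fun i => P.L ^ k * M i) *ᵥ f) ⟨x, μ⟩‖
              ≤ c₁ * P.spacing k * Real.exp (-(t₀ * D / (P.L : ℝ) ^ k)) * F := by
  obtain ⟨t₀, c₁, ht₀, hc₁, H⟩ := decay110_smallField_cube_deriv d L hd1 hd3 hL ha
  refine ⟨t₀, c₁, ht₀, hc₁, ?_⟩
  intro P hPd hPL k hk1 hkK hR U θ hθ hplaq hsmall T hT hsmallT c M hM hfit hN x μ f F D hF hsupp hdeep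
  have hk : k ≤ P.m + P.K := hkK.trans (Nat.le_add_left _ _)
  have hk0 : 0 + k ≤ P.m + P.K := by omega
  have hL1 : (1 : ℝ) < P.L := B1RG242Torus.one_lt_cast_L P
  have ha' : 0 < B1RG242Torus.α P a k * (P.L : ℝ) ^ (k * P.d) :=
    mul_pos (mul_pos (B1.aSeq_pos ha hL1 hk1) (inv_pos.2 (pow_pos (P.spacing_pos k) 2))) (pow_pos P.cast_L_pos _)
  have hc' : P.eps⁻¹ ≠ 0 := inv_ne_zero P.eps_pos.ne'
  have hΩ : IsBlockUnion k (cubeT hPd (P.L ^ k) c fun i => P.L ^ k * M i) := isBlockUnion_cubeT hPd hk rfl hfit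
  obtain ⟨hInt, hTree⟩ := smallField_blockGauge hk0 U hθ hplaq hR hT
  set h : GaugeTransf P 0 U1 := fun z => centredGauge U (cornerIter k (blkIter k z)) (P.L ^ k - 1) z with hh
  rw [← norm_covD_gBox_gaugeAct_mulVec hk0 hc' ha' h U hΩ f x μ]
  exact H P hPd hPL k hk1 hkK c M hM hfit hN (GaugeField.gaugeAct h U) θ T (P.d * ((P.L : ℝ) ^ k - 1) * T) hθ
    (fun p => by rw [norm_toC_plaqHol_gaugeAct_sub_one]; exact hplaq p) hsmall (fun b _ hb => hInt b hb) (fun y _ => hTree y) hsmallT x μ _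
    F D (fun z => by rw [norm_mul, norm_toC, one_mul]; exact hF z) (fun z hz => hsupp z (fun hf => hz (by rw [hf, mul_zero]))) hdeep

/-- **THE SAME IN THE (H1.10″)-type INPUT SHAPE** (distance `B5Ineq137Torus.T`, one power of the spacing, rate `e^{−t₀(L^k)^{−1}D}`, deep rows
as the ball condition `T(x,y) < L^k → y ∈ □`): the derivative twin of p27's `decay110_smallPlaquette_cube_uniform` in the binder shape of §6,
threshold depending on `(d, L^k)` only. [cite: BalabanImbrieJaffe1985, (7.3.1)–(7.3.2) p.326; Balaban1983RegularityDecay, (1.10) p.573] -/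
theorem decay110_smallPlaquette_cube_deriv_uniform_input (d L : ℕ) (hd1 : 1 ≤ d) (hd3 : d + 1 ≤ 3) (hL : Odd L ∧ 1 < L) {a : ℝ}
    (ha : 0 < a) :
    ∃ t₀ c₁ : ℝ, 0 < t₀ ∧ 0 < c₁ ∧ ∀ (P : Params) (hPd : P.d = d + 1), P.L = L →
      ∀ k : ℕ, 1 ≤ k → k ≤ P.K → 2 * (P.L ^ k - 1) + 4 < P.sitesPerDir 0 →
      ∀ (U : GaugeField P 0 U1) (θ : ℝ), 0 ≤ θ →
        (∀ p : Balaban1983to89.Plaq P 0, ‖toC (GaugeField.plaqHol U p) - 1‖ ≤ θ) →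
        2 * (P.d : ℝ) ^ 3 * (((P.L : ℝ) ^ k) ^ 2 * θ) ^ 2 ≤ 1 →
        ∀ (T : ℝ), ((P.d - 1 : ℕ) : ℝ) * ((P.L : ℝ) ^ k - 1) * θ ≤ T →
          2 * (((P.L : ℝ) ^ k - 1) * (P.L : ℝ) ^ k) * P.d * T ^ 2 + 2 * (P.d * ((P.L : ℝ) ^ k - 1) * T) ^ 2 ≤ 1 / 2 →
        ∀ (c M : Fin (d + 1) → ℕ), (∀ i, 1 ≤ M i) → (∀ i, c i * P.L ^ k + P.L ^ k * M i ≤ P.sitesPerDir 0) →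
          (∀ i, P.L ^ k * M i < P.sitesPerDir 0) →
          ∀ (x : Balaban1983to89.Site P 0),
            (∀ y, B5Ineq137Torus.T P 0 x y < (P.L : ℝ) ^ k → y ∈ cubeT hPd (P.L ^ k) c (fun i => P.L ^ k * M i)) →
          ∀ (f : Balaban1983to89.Site P 0 → ℂ) (F D : ℝ), (∀ y, ‖f y‖ ≤ F) → (∀ y, f y ≠ 0 → D ≤ B5Ineq137Torus.T P 0 x y) →
          ∀ (μ : Fin P.d),
            ‖covD P.eps⁻¹ (cfg U) (gBox (B1RG242Torus.α P a k * (P.L : ℝ) ^ (k * P.d)) P.eps⁻¹ U k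
                (cubeT hPd (P.L ^ k) c fun i => P.L ^ k * M i) *ᵥ f) ⟨x, μ⟩‖
              ≤ P.spacing k * (c₁ * Real.exp (-(t₀ * (((P.L : ℝ) ^ k)⁻¹ * D))) * F) := by
  obtain ⟨t₀, c₁, ht₀, hc₁, H⟩ := decay110_smallPlaquette_cube_deriv_uniform d L hd1 hd3 hL ha
  refine ⟨t₀, c₁, ht₀, hc₁, ?_⟩
  intro P hPd hPL k hk1 hkK hR U θ hθ hplaq hsmall T hT hsmallT c M hM hfit hN x hdeep f F D hF hsupp μ
  have h := H P hPd hPL k hk1 hkK hR U θ hθ hplaq hsmall T hT hsmallT c M hM hfit hN x μ f F D hF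
    (fun z hz => by rw [← B3Bound323ZeroTorus.T_eq_supDist]; exact hsupp z hz)
    (fun w hw => by
      by_contra hlt
      exact hw (hdeep w (by rw [B3Bound323ZeroTorus.T_eq_supDist]; exact_mod_cast (not_le.1 hlt))))
  calc _ ≤ c₁ * P.spacing k * Real.exp (-(t₀ * D / (P.L : ℝ) ^ k)) * F := h
    _ = P.spacing k * (c₁ * Real.exp (-(t₀ * (((P.L : ℝ) ^ k)⁻¹ * D))) * F) := by
        rw [show t₀ * D / (P.L : ℝ) ^ k = t₀ * (((P.L : ℝ) ^ k)⁻¹ * D) by ring]; ring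

end Uniform

end

end Literature.MathematicalPhysics.QuantumFieldTheory.BalabanImbrieJaffe1984to88.BIJ88NeumannPropagatorSmallFieldCubeDeriv
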